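import Literature.Barriers.ABC.BakerMethodBoundsWeakArchProofs
import Literature.NumberTheory.DiophantineGeometry.StewartPadicOrderLemma8Proofs
import Mathlib.FieldTheory.IntermediateField.Adjoin.Basic
import Mathlib.FieldTheory.IntermediateField.Adjoin.Algebra
import Mathlib.FieldTheory.Relrank
import Mathlib.FieldTheory.Minpoly.Field
import Mathlib.Algebra.Polynomial.Degree.SmallDegree
import Mathlib.RingTheory.Adjoin.Polynomial.Basic
import Mathlib.Analysis.SpecialFunctions.Sqrt
import Mathlib.LinearAlgebra.Dimension.OrzechProperty
import HarnessLib

/-!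
# Proofs for `BakerMethodBounds`, VI: the archimedean input under a Kummer condition
# (Waldschmidt 1980, Proposition 3.8)

`Literature/Barriers/ABC/BakerMethodBoundsKummerArchProofs.lean` — proofs companion of the
barrier file `Literature/Barriers/ABC/BakerMethodBounds.lean` (theorems only: no definition, no
named fact). `BakerMethodBounds = BakerShapeBound (1/3) 3` is Stewart–Yu 2001, Theorem 1:
`log c ≤ κ · R^{1/3} (log R)³` for coprime positive `a + b = c`, `R = rad(abc)`
[cite: StewartYu2001, Theorem 1]. File III (`BakerMethodBoundsWeakArchProofs.lean`) proved it from
Yu's `p`-adic theorem over `ℚ` plus ANY lower bound for linear forms in `≤ 4` logarithms of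
positive rationals of the clean Baker–Wüstholz shape `log |Λ| > −C(n) A₁⋯Aₙ log(eB)` — a shape
whose printed proofs (Baker–Wüstholz 1993, Philippon–Waldschmidt 1988, Matveev 2000,
Nesterenko 2003) all rest on multiplicity estimates on `𝔾ₐ × 𝔾ₘⁿ` in MULTIDEGREE form.

This file lowers that archimedean input once more, to the "conditional inequality" of
M. Waldschmidt, *A lower bound for linear forms in logarithms*, Acta Arith. 37 (1980),
**Proposition 3.8** (p. 274) for `K = ℚ`, `D = 1`, `q = 2`: Baker's method ("Sharpening III")
with Fel'dman's `Δ`-polynomials and a `2`-descent resting on the KUMMER CONDITION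
`[ℚ(√α₁, …, √αₙ) : ℚ] = 2ⁿ` — twelve pages of classical analysis, no zero estimate and no
geometry of numbers — with Waldschmidt's two extra logarithmic factors
`(W + log(E Vₙ)) · log(E V⁺ₙ₋₁)` allowed and, as in file III, with an ARBITRARY constant
`Cw(n) ≥ 0` in place of his `C₁(n, 2) = 2^{9n+26} n^{n+4}`:

* `BakerMethodBounds_of_padicClause_kummerArchBound`: `BakerMethodBounds` follows from
  (P) the `p`-adic clause (ii) of Pasten's Theorem 2.1 with any absolute `K ≥ 1`, and
  (W) the hypothesis `hW`: for `α₀, …, αₙ` positive rationals `≠ 1` with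
      `[ℚ(√α₀, …, √αₙ) : ℚ] = 2^{n+1}` (stated with `IntermediateField.adjoin ℚ {√αⱼ} ≤ ℝ`),
      integers `bⱼ`, reals `1 ≤ V₀ ≤ ⋯ ≤ Vₙ` with `Vⱼ ≥ max{h(αⱼ), |log αⱼ|}`, `W > 0` with
      `W ≥ h(bⱼ)`, `1 < E ≤ min{e^{V₀}, 4Vⱼ/|log αⱼ|}`, and `Λ = ∑ bⱼ log αⱼ ≠ 0`:
      `|Λ| > exp{−Cw(n+1) V₀⋯Vₙ (W + log(EVₙ)) log(E V⁺ₙ₋₁) (log E)^{-(n+2)}}`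
      (`V⁺ₙ₋₁ = Vₙ₋₁`, `= 1` for a single logarithm) — VERBATIM the body of the statement of
      Waldschmidt's Proposition 3.8 specialised to `ℚ` (his Theorem's hypotheses pp. 257–258,
      §3 p. 263, Prop. 3.8 p. 274), except that the constant is a free function `Cw`; only
      `n + 1 ≤ 4` generators are ever used;
* `BakerMethodBounds_of_thm328Finite_kummerArchBound`, `BakerMethodBounds_of_yu_kummerArchBound`,
  `BakerMethodBounds_of_padicBound_kummerArchBound`, `stewart_yu_of_yu_kummerArchBound`: the
  adapters of file III to Evertse–Győry's Theorem 3.2.8 (finite places) / Yu's Theorem 3.2.7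
  over `ℚ` as printed (the binder `hY` of `Dioph.thm328_rat_finite_of_yu`) / a `p`-adic bound with
  generic constants.

So along this route the undischarged inputs of the barrier declaration are Yu 2007 over `ℚ`
(unchanged, the one deep input) and Waldschmidt 1980, Prop. 3.8 over `ℚ` with `q = 2`.

**The `E = 2` specialisation (the `…₂` theorems).** The assembly only ever applies (W) with `E = 2`,
a value admissible for every family (`2 ≤ e^{V₀}`, `2 ≤ 4Vⱼ/|log αⱼ|`), so each theorem above has a
twin `…₂` whose archimedean hypothesis `hW₂` is (W) at `E = 2` —
`|Λ| > exp{−Cw(n+1) V₀⋯Vₙ (W + log(2Vₙ)) log(2V⁺ₙ₋₁) (log 2)^{-(n+2)}}`, no parameter `E` — and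
the `E`-versions are their corollaries through `kummerArchBound_two`. The twin
`BakerMethodBounds_of_yu_kummerArchBound₂` is the sharpest statement here of what remains to be
proved on the archimedean side: Waldschmidt's Proposition 3.8 for `K = ℚ`, `q = 2` at the single
value `E = 2` of his parameter (so that a proof may fix his `E₁` once and for all), with any
constant.

## Why the Kummer condition costs nothing here

In the second regime of file III (`a² < c`) the linear form is `Λ₀ = log(c/b) = log β +
∑_{q ∣ bc, q > R^{1/4}} e_q log q`, with at most three large primes `q` and `β` the
`R^{1/4}`-smooth part of `c/b`. Write `β = β₀^{2ʲ}` with `β₀` NOT A SQUARE in `ℚ`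
(`exists_eq_pow_two_pow_of_pos`: take square roots while possible, the naive height drops); the
generators become `{q large} ∪ {β₀}` with coefficients `e_q` and `2ʲ ≤ 2 h(β)`. Distinct primes
and a non-square rational which is a unit at these primes have `𝔽₂`-independent square classes
(`not_isSquare_prod_snoc`: an odd valuation, or `β₀` itself), and square roots of positive
rationals with independent square classes generate a multiquadratic field of full degree
`2ⁿ` (`finrank_adjoin_sqrt_eq_two_pow`, by the tower `ℚ ⊂ ℚ(√α₀) ⊂ ⋯`, each step of degree `2`
because a rational square in `F(√α)` is a square in `F` up to the factor `α`, `sq_descent`) —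
this is the Kummer condition at `q = 2`. Waldschmidt's extra factors and the coefficient `2ʲ`
only cost logarithms of `R` and of `log c` (`regimeIIK_logs`): the second regime gives
`log c ≤ M₀ R^{7/24} Λ⁶ Y²` (`log_le_of_sq_lt_kummer`; `Λ = max(1, log R)`, `Y = log max{e, 2 log c}`)
instead of `M₀ R^{7/24} Λ³ Y²`, and `7/24 < 1/3` absorbs it (`regimeII_endgame6`). The first
regime and the degenerate cases are those of file III, unchanged (no archimedean input).

## Contents

* §Multiquadratic (general fields `K ⊆ L`, `char ≠ 2`): `isIntegral_of_sq_mem`,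
  `finrank_adjoin_simple_of_sq_mem` (`[F(y):F] = 2` if `y² ∈ F`, `y ∉ F`),
  `exists_add_mul_of_mem_adjoin_simple` (`F(y) = F + Fy`), `sq_descent`,
  `finrank_adjoin_image_sqrt_and_sq` (the induction), `finrank_adjoin_sqrt_eq_two_pow` (`ℚ ⊂ ℝ`);
* square classes (with `Dioph.padicValRat_finset_prod` of the tree): `not_isSquare_prod_snoc`,
  `not_isSquare_ratCast_prime`, `two_le_max_numNatAbs_den`, `exists_eq_pow_two_pow_of_pos`;
* §KummerArch: `kummerArchBound_two` (`E = 2` is admissible), `kummer_arch_lower_bound₂` /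
  `kummer_arch_lower_bound` (generators `{p ∈ L} ∪ {β₀}`), `kummer_arch_lower_bound_primes₂` /
  `kummer_arch_lower_bound_primes` (primes only, `β₀ :=` one of them);
* §RegimeTwoKummer: `regimeIIK_logs`, `regimeIIK_arith`, `log_le_of_sq_lt_kummer₂` /
  `log_le_of_sq_lt_kummer`;
* §AssemblyKummer: `regimeII_endgame6`, the five theorems above and their `E = 2` twins
  `bakerShapeBound_third_three_of_padicClause_kummerArchBound₂`,
  `BakerMethodBounds_of_padicClause_kummerArchBound₂`, `BakerMethodBounds_of_thm328Finite_kummerArchBound₂`,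
  `BakerMethodBounds_of_yu_kummerArchBound₂`, `BakerMethodBounds_of_padicBound_kummerArchBound₂`,
  `stewart_yu_of_yu_kummerArchBound₂`;
* §MonomialBasis: `prod_sqrt_mul_prod_sqrt`, `linearIndependent_prod_sqrt` (the `2ⁿ` monomials
  `∏_{j ∈ S} √αⱼ` are `ℚ`-linearly independent — the form of the Kummer condition used in the descent);
* §KummerNegOne: `finrank_adjoin_eq_two_pow_of_mul_self_eq` (the `ℝ`-free form, square roots in
  any field `L ⊇ ℚ`), `finrank_adjoin_sqrt_primes_and_neg_one`, `finrank_adjoin_sqrt_primes_I`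
  (`[ℚ(i, √p₀, …, √p_{k-1}) : ℚ] = 2^{k+1}`: Yu 1990 (2.15) for `K = ℚ`, `α₀ = -1`).

## References

* [StewartYu2001] C. L. Stewart, K. Yu, *On the abc conjecture, II*, Duke Math. J. 108 (2001),
  169–181 — Theorem 1 (the method reconstructed in files I–III; their archimedean reference is
  Waldschmidt 1980).
* [Waldschmidt1980] M. Waldschmidt, *A lower bound for linear forms in logarithms*, Acta Arith.
  37 (1980), 257–283, doi:10.4064/aa-37-1-257-283 — Theorem (pp. 257–258), §3 (p. 263),
  Proposition 3.8 (p. 274) (read on the open-access scan, matwbn.icm.edu.pl).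
* [EvertseGyory2015] J.-H. Evertse, K. Győry, *Unit Equations in Diophantine Number Theory*,
  CUP 2015 — Thm 3.2.7, Thm 3.2.8 (p. 62).
* [Pasten2024] H. Pasten, Invent. Math. 236 (2024), 373–385 — Theorem 2.1 (ii).
* [BakerWustholz2007] A. Baker, G. Wüstholz, *Logarithmic Forms and Diophantine Geometry*,
  CUP 2007 — §2.8 (PDF pp. 32–34: the Kummer descent in the history of the bounds), §3.7.
-/

noncomputable section

open Finset Real Height Polynomial IntermediateField
open Literature.NumberTheory.DiophantineGeometry
open Literature.NumberTheory.DiophantineGeometry.Dioph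
open Literature.NumberTheory.DiophantineGeometry.Pasten

namespace Literature.Barriers.ABC

/-! ### Multiquadratic extensions by square roots with independent square classes -/

namespace Multiquadratic

variable {K L : Type*} [Field K] [Field L] [Algebra K L]

/-- An element whose square lies in `F` is integral over `F`. [folklore] -/
theorem isIntegral_of_sq_mem (F : IntermediateField K L) {y : L} (hy2 : y * y ∈ F) :
    IsIntegral F y := by
  have h : IsIntegral F (y ^ 2) := by
    have : y ^ 2 = algebraMap F L ⟨y * y, hy2⟩ := by rw [sq]; rfl
    rw [this]; exact isIntegral_algebraMap
  exact h.of_pow two_pos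

/-- The polynomial `X² − y²` over `F` kills `y`. [folklore] -/
theorem aeval_X_sq_sub_C (F : IntermediateField K L) {y : L} (hy2 : y * y ∈ F) :
    aeval y (X ^ 2 - C (⟨y * y, hy2⟩ : F)) = 0 := by
  simp only [map_sub, map_pow, aeval_X, aeval_C, IntermediateField.algebraMap_apply]
  rw [sq]; exact sub_self _

/-- **A quadratic step has degree `2`:** if `y² ∈ F` and `y ∉ F` then `[F(y) : F] = 2`.
[folklore] -/
theorem finrank_adjoin_simple_of_sq_mem (F : IntermediateField K L) {y : L} (hy2 : y * y ∈ F)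
    (hy : y ∉ F) : Module.finrank F F⟮y⟯ = 2 := by
  have hint := isIntegral_of_sq_mem F hy2
  rw [adjoin.finrank hint]
  apply le_antisymm
  · have hp : (X ^ 2 - C (⟨y * y, hy2⟩ : F)) ≠ 0 := (monic_X_pow_sub_C _ two_ne_zero).ne_zero
    have h := minpoly.degree_le_of_ne_zero F y hp (aeval_X_sq_sub_C F hy2)
    rw [degree_X_pow_sub_C (by norm_num) _] at h
    exact natDegree_le_iff_degree_le.mpr h
  · rw [minpoly.two_le_natDegree_iff hint]
    rintro ⟨z, hz⟩
    apply hy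
    rw [← hz]
    exact z.2

/-- Elements of `F(y)` with `y² ∈ F` are of the form `u + v y` with `u, v ∈ F`. [folklore] -/
theorem exists_add_mul_of_mem_adjoin_simple (F : IntermediateField K L) {y : L}
    (hy2 : y * y ∈ F) {z : L} (hz : z ∈ F⟮y⟯) : ∃ u ∈ F, ∃ v ∈ F, z = u + v * y := by
  have hint := isIntegral_of_sq_mem F hy2
  have hz' : z ∈ (F⟮y⟯).toSubalgebra := hz
  rw [adjoin_simple_toSubalgebra_of_isAlgebraic hint.isAlgebraic,
    Algebra.adjoin_singleton_eq_range_aeval, AlgHom.mem_range] at hz'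
  obtain ⟨f, rfl⟩ := hz'
  set c : F := ⟨y * y, hy2⟩ with hc
  set p : F[X] := X ^ 2 - C c with hp
  have hpm : p.Monic := monic_X_pow_sub_C _ two_ne_zero
  have hroot : aeval y p = 0 := aeval_X_sq_sub_C F hy2
  have hmod : aeval y (f %ₘ p) = aeval y f := aeval_modByMonic_eq_self_of_root hroot
  have hp1 : p ≠ 1 := by
    intro h
    have h' := congrArg natDegree h
    rw [hp, natDegree_X_pow_sub_C, natDegree_one] at h'
    exact two_ne_zero h'
  have hpdeg : p.natDegree = 2 := by rw [hp, natDegree_X_pow_sub_C]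
  have hdeg : (f %ₘ p).natDegree ≤ 1 := by
    have h := natDegree_modByMonic_lt f hpm hp1
    rw [hpdeg] at h
    omega
  refine ⟨((f %ₘ p).coeff 0 : F), SetLike.coe_mem _, ((f %ₘ p).coeff 1 : F), SetLike.coe_mem _, ?_⟩
  rw [← hmod]
  conv_lhs => rw [eq_X_add_C_of_natDegree_le_one hdeg]
  simp only [map_add, map_mul, aeval_C, aeval_X, IntermediateField.algebraMap_apply]
  ring

/-- **Descent of squares through a quadratic step** (characteristic `≠ 2`): if `y² ∈ F`,
`y ∉ F` and `x ∈ F` is a square in `F(y)`, then `x` or `x·y²`… precisely `x = u²` or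
`x = y² v²` with `u, v ∈ F`. [folklore] -/
theorem sq_descent (F : IntermediateField K L) (h2 : (2 : L) ≠ 0) {y : L} (hy2 : y * y ∈ F)
    (hy : y ∉ F) {x : L} (hx : x ∈ F) {z : L} (hz : z ∈ F⟮y⟯) (hxz : x = z * z) :
    (∃ u ∈ F, x = u * u) ∨ (∃ v ∈ F, x = (y * y) * (v * v)) := by
  obtain ⟨u, hu, v, hv, rfl⟩ := exists_add_mul_of_mem_adjoin_simple F hy2 hz
  have key : (2 * u * v) * y = x - (u * u + (y * y) * (v * v)) := by rw [hxz]; ring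
  by_cases huv : 2 * u * v = 0
  · rcases mul_eq_zero.mp huv with h | h
    · rcases mul_eq_zero.mp h with h | h
      · exact absurd h h2
      · right; exact ⟨v, hv, by rw [hxz, h]; ring⟩
    · left; exact ⟨u, hu, by rw [hxz, h]; ring⟩
  · exfalso
    apply hy
    have hy' : y = (x - (u * u + (y * y) * (v * v))) / (2 * u * v) := by
      rw [← key, mul_comm (2 * u * v) y, mul_div_assoc, div_self huv, mul_one]
    rw [hy']
    have htwo : (2 : L) ∈ F := by
      have := add_mem (one_mem F) (one_mem F)
      rwa [one_add_one_eq_two] at this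
    exact div_mem (sub_mem hx (add_mem (mul_mem hu hu) (mul_mem hy2 (mul_mem hv hv))))
      (mul_mem (mul_mem htwo hu) hv)

/-- No roots below `0`. [folklore] -/
theorem image_lt_zero {M : Type*} (y : ℕ → M) : y '' {i | i < 0} = ∅ := by
  simp

/-- One more root. [folklore] -/
theorem image_lt_succ {M : Type*} (y : ℕ → M) (m : ℕ) :
    y '' {i | i < m + 1} = insert (y m) (y '' {i | i < m}) := by
  ext z
  simp only [Set.mem_image, Set.mem_setOf_eq, Set.mem_insert_iff]
  constructor
  · rintro ⟨i, hi, rfl⟩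
    rcases Nat.lt_succ_iff_lt_or_eq.mp hi with h | h
    · exact Or.inr ⟨i, h, rfl⟩
    · exact Or.inl (by rw [h])
  · rintro (rfl | ⟨i, hi, rfl⟩)
    · exact ⟨m, Nat.lt_succ_self m, rfl⟩
    · exact ⟨i, Nat.lt_succ_of_lt hi, rfl⟩

/-- **Multiquadratic extensions by square roots with independent square classes.**
Let `y₀, y₁, … ∈ L` with `yᵢ² = cᵢ ∈ K`, and assume that no product `∏_{i ∈ T} cᵢ` over a
non-empty `T ⊆ {0, …, n-1}` is a square in `K` (`char ≠ 2`). Then for every `m ≤ n`: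
`[K(y₀, …, y_{m-1}) : K] = 2^m`, and a `x ∈ K` which is a square in `K(y₀, …, y_{m-1})` is, up
to a square of `K`, a product of some of the `cᵢ`, `i < m`. (Induction on `m`: the step
`K(y₀,…,y_m) = F(y_m)`, `F = K(y₀,…,y_{m-1})`, has degree `2` because `y_m ∉ F` by the second
clause and the hypothesis, and the second clause climbs by `sq_descent`.) [folklore] -/
theorem finrank_adjoin_image_sqrt_and_sq (h2 : (2 : L) ≠ 0) (y : ℕ → L) (c : ℕ → K)
    (hyc : ∀ i, algebraMap K L (c i) = y i * y i) (n : ℕ)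
    (hind : ∀ T : Finset ℕ, (∀ i ∈ T, i < n) → T.Nonempty → ¬ IsSquare (∏ i ∈ T, c i)) :
    ∀ m ≤ n, Module.finrank K ↥(adjoin K ((y '' {i | i < m}))) = 2 ^ m ∧
      ∀ x : K, (∃ z ∈ adjoin K ((y '' {i | i < m})), algebraMap K L x = z * z) →
        ∃ T : Finset ℕ, (∀ i ∈ T, i < m) ∧ IsSquare (x * ∏ i ∈ T, c i) := by
  intro m
  induction m with
  | zero =>
    intro _
    refine ⟨?_, ?_⟩
    · rw [image_lt_zero, adjoin_empty, IntermediateField.finrank_bot, pow_zero]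
    · rintro x ⟨z, hz, hxz⟩
      rw [image_lt_zero, adjoin_empty, IntermediateField.mem_bot] at hz
      obtain ⟨w, rfl⟩ := hz
      refine ⟨∅, by simp, ⟨w, ?_⟩⟩
      rw [Finset.prod_empty, mul_one]
      apply (algebraMap K L).injective
      rw [hxz, map_mul]
  | succ m ih =>
    intro hm
    obtain ⟨ihrank, ihsq⟩ := ih (Nat.le_of_succ_le hm)
    set F : IntermediateField K L := adjoin K ((y '' {i | i < m})) with hF
    -- `y m ∉ F`
    have hym2 : y m * y m ∈ F := by rw [← hyc m]; exact IntermediateField.algebraMap_mem F (c m)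
    have hym : y m ∉ F := by
      intro hmem
      obtain ⟨T, hT, hsq⟩ := ihsq (c m) ⟨y m, hmem, hyc m⟩
      have hmT : m ∉ T := fun h => lt_irrefl m (hT m h)
      refine hind (insert m T) ?_ (Finset.insert_nonempty m T) ?_
      · intro i hi
        rcases Finset.mem_insert.mp hi with rfl | hi
        · exact hm
        · exact (hT i hi).trans (Nat.lt_of_succ_le hm)
      · rwa [Finset.prod_insert hmT]
    -- the new field as an extension of `F`
    set F' : IntermediateField K L := adjoin K ((y '' {i | i < m + 1})) with hF'
    have hle : F ≤ F' := by
      rw [hF, hF', image_lt_succ]; exact adjoin.mono K _ _ (Set.subset_insert _ _)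
    have hext : extendScalars hle = F⟮y m⟯ := by
      rw [extendScalars_adjoin hle]
      apply le_antisymm
      · rw [adjoin_le_iff, image_lt_succ]
        rintro z (rfl | ⟨i, hi, rfl⟩)
        · exact mem_adjoin_simple_self F _
        · have hmem : y i ∈ F := subset_adjoin K _ (Set.mem_image_of_mem y hi)
          have : (algebraMap F L) ⟨y i, hmem⟩ ∈ F⟮y m⟯ := IntermediateField.algebraMap_mem _ _
          exact this
      · apply adjoin.mono
        rw [image_lt_succ]
        exact Set.singleton_subset_iff.mpr (Set.mem_insert _ _)
    refine ⟨?_, ?_⟩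
    · -- degrees multiply
      have h1 := finrank_bot_mul_relfinrank hle
      rw [relfinrank_eq_finrank_of_le hle, hext, finrank_adjoin_simple_of_sq_mem F hym2 hym,
        ihrank] at h1
      rw [← h1, pow_succ]
    · rintro x ⟨z, hz, hxz⟩
      have hz' : z ∈ F⟮y m⟯ := by
        have : z ∈ extendScalars hle := (mem_extendScalars hle).mpr hz
        rwa [hext] at this
      have hxF : algebraMap K L x ∈ F := IntermediateField.algebraMap_mem F x
      rcases sq_descent F h2 hym2 hym hxF hz' hxz with ⟨u, hu, hxu⟩ | ⟨v, hv, hxv⟩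
      · obtain ⟨T, hT, hsq⟩ := ihsq x ⟨u, hu, hxu⟩
        exact ⟨T, fun i hi => (hT i hi).trans (Nat.lt_succ_self m), hsq⟩
      · -- `x c_m = (c_m v)²` with `c_m v ∈ F`
        have hmem : algebraMap K L (c m) * v ∈ F := mul_mem (IntermediateField.algebraMap_mem F _) hv
        have heq : algebraMap K L (x * c m) = (algebraMap K L (c m) * v) * (algebraMap K L (c m) * v) := by
          rw [map_mul, hxv, hyc m]; ring
        obtain ⟨T, hT, hsq⟩ := ihsq (x * c m) ⟨_, hmem, heq⟩
        have hmT : m ∉ T := fun h => lt_irrefl m (hT m h)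
        refine ⟨insert m T, ?_, ?_⟩
        · intro i hi
          rcases Finset.mem_insert.mp hi with rfl | hi
          · exact Nat.lt_succ_self _
          · exact (hT i hi).trans (Nat.lt_succ_self m)
        · rw [Finset.prod_insert hmT, ← mul_assoc]; exact hsq

end Multiquadratic

open Multiquadratic in
/-- **The Kummer condition at `q = 2` for positive rationals with independent square classes.**
If `α₀, …, α_{n-1} > 0` are rationals such that no product of a non-empty subfamily is a square
in `ℚ`, then `[ℚ(√α₀, …, √α_{n-1}) : ℚ] = 2ⁿ`. [folklore] -/
theorem finrank_adjoin_sqrt_eq_two_pow {n : ℕ} (α : Fin n → ℚ) (hα : ∀ j, 0 ≤ α j)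
    (hind : ∀ T : Finset (Fin n), T.Nonempty → ¬ IsSquare (∏ j ∈ T, α j)) :
    Module.finrank ℚ ↥(IntermediateField.adjoin ℚ (Set.range fun j => Real.sqrt (α j : ℝ))) =
      2 ^ n := by
  classical
  -- extend the family to `ℕ`
  set c : ℕ → ℚ := fun i => if h : i < n then α ⟨i, h⟩ else 0 with hc
  set y : ℕ → ℝ := fun i => Real.sqrt (c i : ℝ) with hy
  have hyc : ∀ i, algebraMap ℚ ℝ (c i) = y i * y i := by
    intro i
    have h0 : (0 : ℝ) ≤ (c i : ℝ) := by
      simp only [hc]; split_ifs with h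
      · exact_mod_cast hα _
      · simp
    change ((c i : ℚ) : ℝ) = _
    rw [hy, Real.mul_self_sqrt h0]
  have hrange : (Set.range fun j : Fin n => Real.sqrt (α j : ℝ)) = (y '' {i | i < n}) := by
    ext z
    simp only [Set.mem_range, Set.mem_image, Set.mem_setOf_eq]
    constructor
    · rintro ⟨j, rfl⟩
      refine ⟨j, j.2, ?_⟩
      simp [hy, hc, j.2]
    · rintro ⟨i, hi, rfl⟩
      refine ⟨⟨i, hi⟩, ?_⟩
      simp [hy, hc, hi]
  have hind' : ∀ T : Finset ℕ, (∀ i ∈ T, i < n) → T.Nonempty → ¬ IsSquare (∏ i ∈ T, c i) := by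
    intro T hT hTne hsq
    set T' : Finset (Fin n) := Finset.univ.filter fun j => (j : ℕ) ∈ T with hT'
    have hmap : T'.map Fin.valEmbedding = T := by
      ext i
      simp only [Finset.mem_map, Finset.mem_filter, Finset.mem_univ, true_and,
        Fin.valEmbedding_apply, hT']
      constructor
      · rintro ⟨j, hj, rfl⟩; exact hj
      · intro hi; exact ⟨⟨i, hT i hi⟩, hi, rfl⟩
    have hprod : ∏ i ∈ T, c i = ∏ j ∈ T', α j := by
      rw [← hmap, Finset.prod_map]
      refine Finset.prod_congr rfl fun j _ => ?_
      simp [hc, j.2]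
    have hT'ne : T'.Nonempty := by
      obtain ⟨i, hi⟩ := hTne
      exact ⟨⟨i, hT i hi⟩, by simp [hT', hi]⟩
    exact hind T' hT'ne (hprod ▸ hsq)
  rw [hrange]
  exact (finrank_adjoin_image_sqrt_and_sq two_ne_zero y c hyc n hind' n le_rfl).1


/-! ### Square classes of distinct primes and of a non-square unit at those primes -/

/-- **Independent square classes:** for distinct primes `p₀, …, p_{k-1}` and a rational
`β₀ ≠ 0` which is not a square and is a unit at each `pᵢ`, no product of a non-empty subfamily
of `(p₀, …, p_{k-1}, β₀)` is a square in `ℚ` (an odd valuation at some `pᵢ`, or `β₀` itself).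
[folklore] -/
theorem not_isSquare_prod_snoc {k : ℕ} (pr : Fin k → ℕ) (hpr : ∀ i, (pr i).Prime)
    (hinj : Function.Injective pr) {β₀ : ℚ} (hβ0 : β₀ ≠ 0) (hβsq : ¬ IsSquare β₀)
    (hν : ∀ i, padicValRat (pr i) β₀ = 0) (T : Finset (Fin (k + 1))) (hT : T.Nonempty) :
    ¬ IsSquare (∏ j ∈ T, (Fin.snoc (fun i => (pr i : ℚ)) β₀ : Fin (k + 1) → ℚ) j) := by
  classical
  set α : Fin (k + 1) → ℚ := Fin.snoc (fun i => (pr i : ℚ)) β₀ with hα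
  have hα0 : ∀ j, α j ≠ 0 := by
    intro j
    rcases Fin.eq_castSucc_or_eq_last j with ⟨i, rfl⟩ | rfl
    · simp only [hα, Fin.snoc_castSucc]; exact_mod_cast (hpr i).ne_zero
    · simpa only [hα, Fin.snoc_last] using hβ0
  rintro ⟨r, hr⟩
  have hprod0 : ∏ j ∈ T, α j ≠ 0 := Finset.prod_ne_zero_iff.mpr fun j _ => hα0 j
  have hr0 : r ≠ 0 := by
    rintro rfl; rw [mul_zero] at hr; exact hprod0 hr
  by_cases h : ∃ i, Fin.castSucc i ∈ T
  · obtain ⟨i, hi⟩ := h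
    haveI : Fact (pr i).Prime := ⟨hpr i⟩
    have hval : ∀ j, padicValRat (pr i) (α j) = if j = Fin.castSucc i then 1 else 0 := by
      intro j
      rcases Fin.eq_castSucc_or_eq_last j with ⟨i', rfl⟩ | rfl
      · simp only [hα, Fin.snoc_castSucc, padicValRat.of_nat, Fin.castSucc_inj]
        by_cases hii : i' = i
        · subst hii; simp [padicValNat_self]
        · haveI : Fact (pr i').Prime := ⟨hpr i'⟩
          rw [padicValNat_primes (fun h => hii (hinj h).symm), if_neg hii]; simp
      · simp only [hα, Fin.snoc_last, hν i]
        rw [if_neg (Fin.castSucc_ne_last i).symm]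
    have h1 : padicValRat (pr i) (∏ j ∈ T, α j) = 1 := by
      rw [padicValRat_finset_prod _ T α fun j _ => hα0 j]
      simp only [hval, Finset.sum_ite_eq', if_pos hi]
    have h2 : padicValRat (pr i) (∏ j ∈ T, α j) = 2 * padicValRat (pr i) r := by
      rw [hr, padicValRat.mul hr0 hr0]; ring
    omega
  · push Not at h
    have hTsub : ∀ j ∈ T, j = Fin.last k := by
      intro j hj
      rcases Fin.eq_castSucc_or_eq_last j with ⟨i, rfl⟩ | rfl
      · exact absurd hj (h i)
      · rfl
    have hTeq : T = {Fin.last k} := by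
      apply Finset.eq_singleton_iff_unique_mem.mpr
      obtain ⟨j, hj⟩ := hT
      exact ⟨hTsub j hj ▸ hj, hTsub⟩
    apply hβsq
    refine ⟨r, ?_⟩
    rw [hTeq, Finset.prod_singleton] at hr
    simpa only [hα, Fin.snoc_last] using hr

/-! ### Extracting `2`-power roots -/

/-- The naive height `max(|num|, den)` of a positive rational `≠ 1` is at least `2`. [folklore] -/
theorem two_le_max_numNatAbs_den {γ : ℚ} (hγ0 : 0 < γ) (hγ1 : γ ≠ 1) :
    2 ≤ max γ.num.natAbs γ.den := by
  by_contra h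
  push Not at h
  have hden : γ.den = 1 := by
    have := γ.den_pos
    have : γ.den ≤ 1 := (le_max_right _ _).trans (Nat.lt_succ_iff.mp h)
    omega
  have hnum : γ.num = 1 := by
    have h1 : γ.num.natAbs ≤ 1 := (le_max_left _ _).trans (Nat.lt_succ_iff.mp h)
    have h2 : 0 < γ.num := Rat.num_pos.mpr hγ0
    omega
  apply hγ1
  rw [← Rat.num_div_den γ, hnum, hden]
  norm_num

/-- **Every positive rational `β ≠ 1` is a `2ʲ`-th power of a non-square positive rational.**
(Take square roots while possible; the naive height drops.) [folklore] -/
theorem exists_eq_pow_two_pow_of_pos {β : ℚ} (hβ0 : 0 < β) (hβ1 : β ≠ 1) :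
    ∃ β₀ : ℚ, ∃ j : ℕ, 0 < β₀ ∧ β₀ ≠ 1 ∧ ¬ IsSquare β₀ ∧ β = β₀ ^ (2 ^ j) := by
  suffices key : ∀ N : ℕ, ∀ β : ℚ, 0 < β → β ≠ 1 → max β.num.natAbs β.den ≤ N →
      ∃ β₀ : ℚ, ∃ j : ℕ, 0 < β₀ ∧ β₀ ≠ 1 ∧ ¬ IsSquare β₀ ∧ β = β₀ ^ (2 ^ j) from
    key _ β hβ0 hβ1 le_rfl
  intro N
  induction N using Nat.strong_induction_on with
  | _ N ih =>
    intro β hβ0 hβ1 hN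
    by_cases hsq : IsSquare β
    · obtain ⟨γ, hγ⟩ := hsq
      set γ' : ℚ := |γ| with hγ'
      have hβγ : β = γ' ^ 2 := by rw [hγ, hγ', sq, abs_mul_abs_self]
      have hγ0 : γ ≠ 0 := by rintro rfl; rw [mul_zero] at hγ; exact hβ0.ne' hγ
      have hγ'0 : 0 < γ' := abs_pos.mpr hγ0
      have hγ'1 : γ' ≠ 1 := by rintro h; apply hβ1; rw [hβγ, h]; norm_num
      -- the naive height is the square
      have hH : ((max β.num.natAbs β.den : ℕ) : ℝ) = ((max γ'.num.natAbs γ'.den : ℕ) : ℝ) ^ 2 := by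
        have h1 : Height.mulHeight₁ β = Height.mulHeight₁ γ' ^ 2 := by
          rw [hβγ, Height.mulHeight₁_pow]
        rwa [Rat.mulHeight₁_eq_max β, Rat.mulHeight₁_eq_max γ'] at h1
      have hHnat : max β.num.natAbs β.den = (max γ'.num.natAbs γ'.den) ^ 2 := by
        exact_mod_cast hH
      have h2 := two_le_max_numNatAbs_den hγ'0 hγ'1
      have hlt : max γ'.num.natAbs γ'.den < N := by
        have : max γ'.num.natAbs γ'.den < (max γ'.num.natAbs γ'.den) ^ 2 := by nlinarith
        omega
      obtain ⟨β₀, j, h0, h1, hns, hpow⟩ := ih _ hlt γ' hγ'0 hγ'1 le_rfl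
      refine ⟨β₀, j + 1, h0, h1, hns, ?_⟩
      rw [hβγ, hpow, ← pow_mul, pow_succ]
    · exact ⟨β, 0, hβ0, hβ1, hsq, by simp⟩


/-! ### The archimedean bound under the Kummer condition, applied to few generators -/

section KummerArch

variable (Cw : ℕ → ℝ)

/-- `h(z) = log max(|z|, 1)` for an integer `z`. [folklore] -/
theorem logHeight₁_intCast_eq (z : ℤ) : logHeight₁ ((z : ℚ)) = Real.log (max (|(z : ℝ)|) 1) := by
  rw [Rat.logHeight₁_eq_log_max]
  congr 1
  rw [Rat.num_intCast, Rat.den_intCast]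
  push_cast
  rw [Nat.cast_natAbs, Int.cast_abs]

/-- **The `E = 2` specialisation of the Kummer-conditional archimedean hypothesis.** The value
`E = 2` is admissible for every family in Waldschmidt's Proposition 3.8 over `ℚ`
(`2 ≤ e ≤ e^{V₀}` as `V₀ ≥ 1`, and `2 ≤ 4 ≤ 4Vⱼ/|log αⱼ|` as `Vⱼ ≥ |log αⱼ| > 0`), so the bound
with the parameter `E` free implies the bound at `E = 2` — which is all this file ever uses.
[cite: Waldschmidt1980, Prop 3.8 (p. 274); Theorem, pp. 257–258 (the range of `E`)] -/
theorem kummerArchBound_two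
    (hW : ∀ (n : ℕ) (α : Fin (n + 1) → ℚ) (b : Fin (n + 1) → ℤ) (V : Fin (n + 1) → ℝ) (W E : ℝ),
      (∀ j, 0 < α j ∧ α j ≠ 1) →
      Module.finrank ℚ ↥(IntermediateField.adjoin ℚ
          (Set.range fun j => Real.sqrt (α j : ℝ))) = 2 ^ (n + 1) →
      Monotone V → 1 ≤ V 0 →
      (∀ j, max (logHeight₁ (α j)) |Real.log (α j : ℝ)| ≤ V j) →
      0 < W → (∀ j, logHeight₁ (b j : ℚ) ≤ W) →
      1 < E → E ≤ Real.exp (V 0) → (∀ j, E ≤ 4 * V j / |Real.log (α j : ℝ)|) →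
      ∑ j, (b j : ℝ) * Real.log (α j : ℝ) ≠ 0 →
      Real.exp (-(Cw (n + 1) * (∏ j, V j) * (W + Real.log (E * V (Fin.last n))) *
          Real.log (E * (if n = 0 then 1 else V ⟨n - 1, by omega⟩)) / Real.log E ^ (n + 2))) <
        |∑ j, (b j : ℝ) * Real.log (α j : ℝ)|) :
    ∀ (n : ℕ) (α : Fin (n + 1) → ℚ) (b : Fin (n + 1) → ℤ) (V : Fin (n + 1) → ℝ) (W : ℝ),
      (∀ j, 0 < α j ∧ α j ≠ 1) →
      Module.finrank ℚ ↥(IntermediateField.adjoin ℚ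
          (Set.range fun j => Real.sqrt (α j : ℝ))) = 2 ^ (n + 1) →
      Monotone V → 1 ≤ V 0 →
      (∀ j, max (logHeight₁ (α j)) |Real.log (α j : ℝ)| ≤ V j) →
      0 < W → (∀ j, logHeight₁ (b j : ℚ) ≤ W) →
      ∑ j, (b j : ℝ) * Real.log (α j : ℝ) ≠ 0 →
      Real.exp (-(Cw (n + 1) * (∏ j, V j) * (W + Real.log (2 * V (Fin.last n))) *
          Real.log (2 * (if n = 0 then 1 else V ⟨n - 1, by omega⟩)) / Real.log 2 ^ (n + 2))) <
        |∑ j, (b j : ℝ) * Real.log (α j : ℝ)| := by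
  intro n α b V W hαpos hKum hmono hV0 hVj hW0 hWb hΛ
  have he2 : (2 : ℝ) ≤ Real.exp 1 := by have := Real.add_one_le_exp (1 : ℝ); linarith
  have hE2 : (2 : ℝ) ≤ Real.exp (V 0) := he2.trans (Real.exp_le_exp.mpr hV0)
  have hE4 : ∀ j, (2 : ℝ) ≤ 4 * V j / |Real.log (α j : ℝ)| := by
    intro j
    have hpos : 0 < |Real.log (α j : ℝ)| := by
      have h0 : (0 : ℝ) < (α j : ℝ) := by exact_mod_cast (hαpos j).1
      have h1 : (α j : ℝ) ≠ 1 := by exact_mod_cast (hαpos j).2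
      exact abs_pos.mpr (Real.log_ne_zero_of_pos_of_ne_one h0 h1)
    have hle : |Real.log (α j : ℝ)| ≤ V j := (le_max_right _ _).trans (hVj j)
    rw [le_div_iff₀ hpos]; linarith
  exact hW n α b V W 2 hαpos hKum hmono hV0 hVj hW0 hWb one_lt_two hE2 hE4 hΛ

/-- **The archimedean bound for `Λ = m log β₀ + ∑_{p ∈ L} e_p log p` under the `2`-Kummer
condition** (`L` a set of primes, `β₀ > 0` a non-square rational `≠ 1` which is a unit at the
primes of `L`; `|e_p|, |m| ≤ B`, `log p ≤ Λ₁` on `L`, `Λ₁ ≥ 1`), from the `E = 2` form `hW₂` of a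
lower bound of the shape of Waldschmidt's Proposition 3.8 (`K = ℚ`, `q = 2`) with ANY constant
`Cw(n) ≥ 0`, applied to the `#L + 1` generators `(p)_{p ∈ L}, β₀` with `V_p = Λ₁`,
`V_{β₀} = max(h(β₀), Λ₁)`, `W = log(eB)` (the family `(√p)_{p ∈ L}, √β₀` generates a field of
degree `2^{#L+1}` by `finrank_adjoin_sqrt_eq_two_pow` and `not_isSquare_prod_snoc`):
`log |Λ| > −Cw(#L+1) · Λ₁^{#L} H · (log(eB) + log(2H)) · log(2Λ₁) / (log 2)^{#L+2}`,
`H = max(h(β₀), Λ₁)`. [cite: Waldschmidt1980, Prop 3.8 (p. 274)] -/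
theorem kummer_arch_lower_bound₂ (hCw : ∀ n, 0 ≤ Cw n)
    (hW₂ : ∀ (n : ℕ) (α : Fin (n + 1) → ℚ) (b : Fin (n + 1) → ℤ) (V : Fin (n + 1) → ℝ) (W : ℝ),
      (∀ j, 0 < α j ∧ α j ≠ 1) →
      Module.finrank ℚ ↥(IntermediateField.adjoin ℚ
          (Set.range fun j => Real.sqrt (α j : ℝ))) = 2 ^ (n + 1) →
      Monotone V → 1 ≤ V 0 →
      (∀ j, max (logHeight₁ (α j)) |Real.log (α j : ℝ)| ≤ V j) →
      0 < W → (∀ j, logHeight₁ (b j : ℚ) ≤ W) →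
      ∑ j, (b j : ℝ) * Real.log (α j : ℝ) ≠ 0 →
      Real.exp (-(Cw (n + 1) * (∏ j, V j) * (W + Real.log (2 * V (Fin.last n))) *
          Real.log (2 * (if n = 0 then 1 else V ⟨n - 1, by omega⟩)) / Real.log 2 ^ (n + 2))) <
        |∑ j, (b j : ℝ) * Real.log (α j : ℝ)|)
    (L : Finset ℕ) (hL : ∀ p ∈ L, p.Prime) (e : ℕ → ℤ)
    {β₀ : ℚ} (hβ0 : 0 < β₀) (hβ1 : β₀ ≠ 1) (hβsq : ¬ IsSquare β₀)
    (hν : ∀ p ∈ L, padicValRat p β₀ = 0) (m : ℤ)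
    {Λ₁ : ℝ} (hΛ₁ : 1 ≤ Λ₁) (hΛL : ∀ p ∈ L, Real.log p ≤ Λ₁)
    {B : ℝ} (hB1 : 1 ≤ B) (hBe : ∀ p ∈ L, (|e p| : ℝ) ≤ B) (hBm : (|m| : ℝ) ≤ B)
    (hΛ : (m : ℝ) * Real.log (β₀ : ℝ) + ∑ p ∈ L, (e p : ℝ) * Real.log p ≠ 0) :
    -(Cw (L.card + 1) * (Λ₁ ^ L.card * max (logHeight₁ β₀) Λ₁) *
        (Real.log (Real.exp 1 * B) + Real.log (2 * max (logHeight₁ β₀) Λ₁)) *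
        Real.log (2 * Λ₁) / Real.log 2 ^ (L.card + 2)) <
      Real.log |(m : ℝ) * Real.log (β₀ : ℝ) + ∑ p ∈ L, (e p : ℝ) * Real.log p| := by
  classical
  set k : ℕ := L.card with hk
  set pr : Fin k → ℕ := fun i => L.orderEmbOfFin hk.symm i with hpr
  have hprL : ∀ i, pr i ∈ L := fun i => L.orderEmbOfFin_mem hk.symm i
  have hprp : ∀ i, (pr i).Prime := fun i => hL _ (hprL i)
  have hinj : Function.Injective pr := (L.orderEmbOfFin hk.symm).injective
  set α : Fin (k + 1) → ℚ := Fin.snoc (fun i => (pr i : ℚ)) β₀ with hα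
  set b : Fin (k + 1) → ℤ := Fin.snoc (fun i => e (pr i)) m with hb
  set H : ℝ := max (logHeight₁ β₀) Λ₁ with hH
  set V : Fin (k + 1) → ℝ := Fin.snoc (fun _ => Λ₁) H with hV
  set W : ℝ := Real.log (Real.exp 1 * B) with hWdef
  have hHΛ : Λ₁ ≤ H := le_max_right _ _
  have hH1 : 1 ≤ H := hΛ₁.trans hHΛ
  have he2 : (2 : ℝ) ≤ Real.exp 1 := by have := Real.add_one_le_exp (1 : ℝ); linarith
  -- hypotheses of `hW₂`
  have hαpos : ∀ j, 0 < α j ∧ α j ≠ 1 := by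
    intro j
    rcases Fin.eq_castSucc_or_eq_last j with ⟨i, rfl⟩ | rfl
    · simp only [hα, Fin.snoc_castSucc]
      exact ⟨by exact_mod_cast (hprp i).pos, by exact_mod_cast (hprp i).one_lt.ne'⟩
    · simp only [hα, Fin.snoc_last]; exact ⟨hβ0, hβ1⟩
  have hKum : Module.finrank ℚ ↥(IntermediateField.adjoin ℚ
      (Set.range fun j => Real.sqrt (α j : ℝ))) = 2 ^ (k + 1) :=
    finrank_adjoin_sqrt_eq_two_pow α (fun j => (hαpos j).1.le)
      (not_isSquare_prod_snoc pr hprp hinj hβ0.ne' hβsq fun i => hν _ (hprL i))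
  have hmono : Monotone V := by
    intro i j hij
    rcases Fin.eq_castSucc_or_eq_last j with ⟨j', rfl⟩ | rfl
    · rcases Fin.eq_castSucc_or_eq_last i with ⟨i', rfl⟩ | rfl
      · simp only [hV, Fin.snoc_castSucc]; exact le_rfl
      · exact absurd hij (not_le.mpr (Fin.castSucc_lt_last j'))
    · rcases Fin.eq_castSucc_or_eq_last i with ⟨i', rfl⟩ | rfl
      · simp only [hV, Fin.snoc_castSucc, Fin.snoc_last]; exact hHΛ
      · exact le_rfl
  have hVge : ∀ j, Λ₁ ≤ V j := by
    intro j
    rcases Fin.eq_castSucc_or_eq_last j with ⟨i, rfl⟩ | rfl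
    · simp only [hV, Fin.snoc_castSucc]; exact le_rfl
    · simp only [hV, Fin.snoc_last]; exact hHΛ
  have hV0 : 1 ≤ V 0 := hΛ₁.trans (hVge 0)
  have hVj : ∀ j, max (logHeight₁ (α j)) |Real.log (α j : ℝ)| ≤ V j := by
    intro j
    rcases Fin.eq_castSucc_or_eq_last j with ⟨i, rfl⟩ | rfl
    · simp only [hα, hV, Fin.snoc_castSucc]
      have hp := hprp i
      haveI : NeZero (pr i) := ⟨hp.ne_zero⟩
      have hlog0 : 0 ≤ Real.log (pr i : ℝ) := Real.log_nonneg (by exact_mod_cast hp.one_lt.le)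
      rw [Rat.logHeight₁_natCast, Rat.cast_natCast, abs_of_nonneg hlog0, max_self]
      exact hΛL _ (hprL i)
    · simp only [hα, hV, Fin.snoc_last]
      refine max_le (le_max_left _ _) ?_
      have h := abs_log_abs_le_logHeight₁ hβ0.ne'
      rw [abs_of_pos (show (0 : ℝ) < ((β₀ : ℚ) : ℝ) by exact_mod_cast hβ0)] at h
      exact h.trans (le_max_left _ _)
  have hW1 : 1 ≤ W := by
    rw [hWdef, Real.log_mul (Real.exp_pos 1).ne' (by linarith), Real.log_exp]
    linarith [Real.log_nonneg hB1]
  have hW0 : 0 < W := by linarith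
  have hWb : ∀ j, logHeight₁ (b j : ℚ) ≤ W := by
    intro j
    have hbj : (|(b j : ℝ)|) ≤ B := by
      rcases Fin.eq_castSucc_or_eq_last j with ⟨i, rfl⟩ | rfl
      · simp only [hb, Fin.snoc_castSucc]; exact hBe _ (hprL i)
      · simp only [hb, Fin.snoc_last]; exact hBm
    rw [logHeight₁_intCast_eq, hWdef]
    apply Real.log_le_log (by positivity)
    calc max (|(b j : ℝ)|) 1 ≤ B := max_le hbj hB1
      _ = 1 * B := (one_mul B).symm
      _ ≤ Real.exp 1 * B := by gcongr; linarith
  have hsum : ∑ j, (b j : ℝ) * Real.log (α j : ℝ) =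
      (m : ℝ) * Real.log (β₀ : ℝ) + ∑ p ∈ L, (e p : ℝ) * Real.log p := by
    rw [Fin.sum_univ_castSucc]
    simp only [hα, hb, Fin.snoc_castSucc, Fin.snoc_last, Rat.cast_natCast]
    rw [add_comm]
    congr 1
    have himg : Finset.image pr Finset.univ = L := by
      rw [hpr]; exact Finset.image_orderEmbOfFin_univ L hk.symm
    rw [← Finset.sum_image (f := fun p : ℕ => (e p : ℝ) * Real.log p)
      (fun i _ j _ h => hinj h), himg]
  have hprodV : ∏ j, V j = Λ₁ ^ k * H := by
    rw [Fin.prod_univ_castSucc]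
    simp only [hV, Fin.snoc_castSucc, Fin.snoc_last, Finset.prod_const, Finset.card_univ,
      Fintype.card_fin]
  -- apply the hypothesis
  have key := hW₂ k α b V W hαpos hKum hmono hV0 hVj hW0 hWb (by rw [hsum]; exact hΛ)
  rw [hsum, hprodV] at key
  have hlast : V (Fin.last k) = H := by simp only [hV, Fin.snoc_last]
  have hsecond : (if k = 0 then (1 : ℝ) else V ⟨k - 1, by omega⟩) ≤ Λ₁ := by
    split_ifs with h0
    · exact hΛ₁
    · have hcast : (⟨k - 1, by omega⟩ : Fin (k + 1)) = Fin.castSucc ⟨k - 1, by omega⟩ := rfl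
      rw [hcast]; simp only [hV, Fin.snoc_castSucc]; exact le_rfl
  have hsecond1 : 1 ≤ (if k = 0 then (1 : ℝ) else V ⟨k - 1, by omega⟩) := by
    split_ifs with h0
    · exact le_rfl
    · have hcast : (⟨k - 1, by omega⟩ : Fin (k + 1)) = Fin.castSucc ⟨k - 1, by omega⟩ := rfl
      rw [hcast]; simp only [hV, Fin.snoc_castSucc]; exact hΛ₁
  rw [hlast] at key
  -- monotonicity of the exponent in the second-top value
  have hlog2 : 0 < Real.log 2 := Real.log_pos one_lt_two
  have hΛH0 : 0 ≤ Λ₁ ^ k * H := by positivity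
  have hWH : 0 ≤ W + Real.log (2 * H) := by
    have : 0 ≤ Real.log (2 * H) := Real.log_nonneg (by linarith)
    linarith
  have hfac : Real.log (2 * (if k = 0 then (1 : ℝ) else V ⟨k - 1, by omega⟩)) ≤
      Real.log (2 * Λ₁) := Real.log_le_log (by linarith) (by linarith)
  have hUle : Cw (k + 1) * (Λ₁ ^ k * H) * (W + Real.log (2 * H)) *
        Real.log (2 * (if k = 0 then (1 : ℝ) else V ⟨k - 1, by omega⟩)) / Real.log 2 ^ (k + 2) ≤
      Cw (k + 1) * (Λ₁ ^ k * H) * (W + Real.log (2 * H)) * Real.log (2 * Λ₁) /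
        Real.log 2 ^ (k + 2) := by
    apply div_le_div_of_nonneg_right _ (by positivity)
    exact mul_le_mul_of_nonneg_left hfac (mul_nonneg (mul_nonneg (hCw _) hΛH0) hWH)
  have hpos : 0 < |(m : ℝ) * Real.log (β₀ : ℝ) + ∑ p ∈ L, (e p : ℝ) * Real.log p| :=
    abs_pos.mpr hΛ
  rw [Real.lt_log_iff_exp_lt hpos]
  exact lt_of_le_of_lt (Real.exp_le_exp.mpr (neg_le_neg hUle)) key

/-- **The archimedean bound for `Λ = m log β₀ + ∑_{p ∈ L} e_p log p` under the `2`-Kummer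
condition** (`L` a set of primes, `β₀ > 0` a non-square rational `≠ 1` which is a unit at the
primes of `L`; `|e_p|, |m| ≤ B`, `log p ≤ Λ₁` on `L`, `Λ₁ ≥ 1`), from a lower bound of the shape
of Waldschmidt's Proposition 3.8 (`K = ℚ`, `q = 2`) with ANY constant `Cw(n) ≥ 0`, applied to the
`#L + 1` generators `(p)_{p ∈ L}, β₀` with `V_p = Λ₁`, `V_{β₀} = max(h(β₀), Λ₁)`, `W = log(eB)`,
`E = 2` (the family `(√p)_{p ∈ L}, √β₀` generates a field of degree `2^{#L+1}` by
`finrank_adjoin_sqrt_eq_two_pow` and `not_isSquare_prod_snoc`):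
`log |Λ| > −Cw(#L+1) · Λ₁^{#L} H · (log(eB) + log(2H)) · log(2Λ₁) / (log 2)^{#L+2}`,
`H = max(h(β₀), Λ₁)`. [cite: Waldschmidt1980, Prop 3.8 (p. 274)] -/
theorem kummer_arch_lower_bound (hCw : ∀ n, 0 ≤ Cw n)
    (hW : ∀ (n : ℕ) (α : Fin (n + 1) → ℚ) (b : Fin (n + 1) → ℤ) (V : Fin (n + 1) → ℝ) (W E : ℝ),
      (∀ j, 0 < α j ∧ α j ≠ 1) →
      Module.finrank ℚ ↥(IntermediateField.adjoin ℚ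
          (Set.range fun j => Real.sqrt (α j : ℝ))) = 2 ^ (n + 1) →
      Monotone V → 1 ≤ V 0 →
      (∀ j, max (logHeight₁ (α j)) |Real.log (α j : ℝ)| ≤ V j) →
      0 < W → (∀ j, logHeight₁ (b j : ℚ) ≤ W) →
      1 < E → E ≤ Real.exp (V 0) → (∀ j, E ≤ 4 * V j / |Real.log (α j : ℝ)|) →
      ∑ j, (b j : ℝ) * Real.log (α j : ℝ) ≠ 0 →
      Real.exp (-(Cw (n + 1) * (∏ j, V j) * (W + Real.log (E * V (Fin.last n))) *
          Real.log (E * (if n = 0 then 1 else V ⟨n - 1, by omega⟩)) / Real.log E ^ (n + 2))) <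
        |∑ j, (b j : ℝ) * Real.log (α j : ℝ)|)
    (L : Finset ℕ) (hL : ∀ p ∈ L, p.Prime) (e : ℕ → ℤ)
    {β₀ : ℚ} (hβ0 : 0 < β₀) (hβ1 : β₀ ≠ 1) (hβsq : ¬ IsSquare β₀)
    (hν : ∀ p ∈ L, padicValRat p β₀ = 0) (m : ℤ)
    {Λ₁ : ℝ} (hΛ₁ : 1 ≤ Λ₁) (hΛL : ∀ p ∈ L, Real.log p ≤ Λ₁)
    {B : ℝ} (hB1 : 1 ≤ B) (hBe : ∀ p ∈ L, (|e p| : ℝ) ≤ B) (hBm : (|m| : ℝ) ≤ B)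
    (hΛ : (m : ℝ) * Real.log (β₀ : ℝ) + ∑ p ∈ L, (e p : ℝ) * Real.log p ≠ 0) :
    -(Cw (L.card + 1) * (Λ₁ ^ L.card * max (logHeight₁ β₀) Λ₁) *
        (Real.log (Real.exp 1 * B) + Real.log (2 * max (logHeight₁ β₀) Λ₁)) *
        Real.log (2 * Λ₁) / Real.log 2 ^ (L.card + 2)) <
      Real.log |(m : ℝ) * Real.log (β₀ : ℝ) + ∑ p ∈ L, (e p : ℝ) * Real.log p| :=
  kummer_arch_lower_bound₂ Cw hCw (kummerArchBound_two Cw hW) L hL e hβ0 hβ1 hβsq hν m hΛ₁ hΛL hB1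
    hBe hBm hΛ

/-- A prime is not a square in `ℚ` (its valuation at itself is odd). [folklore] -/
theorem not_isSquare_ratCast_prime {p : ℕ} (hp : p.Prime) : ¬ IsSquare ((p : ℕ) : ℚ) := by
  rintro ⟨r, hr⟩
  haveI : Fact p.Prime := ⟨hp⟩
  have hr0 : r ≠ 0 := by
    rintro rfl
    rw [mul_zero] at hr
    exact (Nat.cast_ne_zero.mpr hp.ne_zero) hr
  have h1 : padicValRat p (p : ℚ) = 1 := padicValRat.self hp.one_lt
  rw [hr, padicValRat.mul hr0 hr0] at h1
  omega

/-- **The same for `Λ = ∑_{p ∈ L} e_p log p` (no `β₀`)**, from the `E = 2` form `hW₂`, `L` a set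
of at least one prime: the generators `(p)_{p ∈ L}` alone (distinct primes have independent square
classes). Here all `V_p = Λ₁` and the bound reads
`log |Λ| > −Cw(#L) · Λ₁^{#L} · (log(eB) + log(2Λ₁)) · log(2Λ₁) / (log 2)^{#L+1}`.
[cite: Waldschmidt1980, Prop 3.8 (p. 274)] -/
theorem kummer_arch_lower_bound_primes₂ (hCw : ∀ n, 0 ≤ Cw n)
    (hW₂ : ∀ (n : ℕ) (α : Fin (n + 1) → ℚ) (b : Fin (n + 1) → ℤ) (V : Fin (n + 1) → ℝ) (W : ℝ),
      (∀ j, 0 < α j ∧ α j ≠ 1) →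
      Module.finrank ℚ ↥(IntermediateField.adjoin ℚ
          (Set.range fun j => Real.sqrt (α j : ℝ))) = 2 ^ (n + 1) →
      Monotone V → 1 ≤ V 0 →
      (∀ j, max (logHeight₁ (α j)) |Real.log (α j : ℝ)| ≤ V j) →
      0 < W → (∀ j, logHeight₁ (b j : ℚ) ≤ W) →
      ∑ j, (b j : ℝ) * Real.log (α j : ℝ) ≠ 0 →
      Real.exp (-(Cw (n + 1) * (∏ j, V j) * (W + Real.log (2 * V (Fin.last n))) *
          Real.log (2 * (if n = 0 then 1 else V ⟨n - 1, by omega⟩)) / Real.log 2 ^ (n + 2))) <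
        |∑ j, (b j : ℝ) * Real.log (α j : ℝ)|)
    (L : Finset ℕ) (hL : ∀ p ∈ L, p.Prime) (hL1 : 1 ≤ L.card) (e : ℕ → ℤ)
    {Λ₁ : ℝ} (hΛ₁ : 1 ≤ Λ₁) (hΛL : ∀ p ∈ L, Real.log p ≤ Λ₁)
    {B : ℝ} (hB1 : 1 ≤ B) (hBe : ∀ p ∈ L, (|e p| : ℝ) ≤ B)
    (hΛ : ∑ p ∈ L, (e p : ℝ) * Real.log p ≠ 0) :
    -(Cw L.card * Λ₁ ^ L.card * (Real.log (Real.exp 1 * B) + Real.log (2 * Λ₁)) *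
        Real.log (2 * Λ₁) / Real.log 2 ^ (L.card + 1)) <
      Real.log |∑ p ∈ L, (e p : ℝ) * Real.log p| := by
  classical
  -- split off one prime `p₁` of `L` and use the previous lemma with `β₀ := p₁`
  -- (a prime is not a square in `ℚ` and is a unit at the other primes)
  obtain ⟨p₁, hp₁L⟩ : L.Nonempty := Finset.card_pos.mp hL1
  set L' : Finset ℕ := L.erase p₁ with hL'
  have hp₁ : p₁.Prime := hL _ hp₁L
  have hL'sub : L' ⊆ L := Finset.erase_subset _ _
  have hL'prime : ∀ p ∈ L', p.Prime := fun p hp => hL p (hL'sub hp)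
  have hcard : L'.card + 1 = L.card := by
    rw [hL', Finset.card_erase_of_mem hp₁L]; omega
  have hβ0 : (0 : ℚ) < (p₁ : ℚ) := by exact_mod_cast hp₁.pos
  have hβ1 : (p₁ : ℚ) ≠ 1 := by exact_mod_cast hp₁.one_lt.ne'
  have hβsq : ¬ IsSquare ((p₁ : ℕ) : ℚ) := not_isSquare_ratCast_prime hp₁
  have hν : ∀ p ∈ L', padicValRat p (p₁ : ℚ) = 0 := by
    intro p hp
    have hpp : p.Prime := hL'prime p hp
    have hne : p ≠ p₁ := Finset.ne_of_mem_erase hp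
    haveI : Fact p.Prime := ⟨hpp⟩
    haveI : Fact p₁.Prime := ⟨hp₁⟩
    rw [padicValRat.of_nat, padicValNat_primes hne, Nat.cast_zero]
  have hsplit : ∑ p ∈ L, (e p : ℝ) * Real.log p =
      (e p₁ : ℝ) * Real.log ((p₁ : ℚ) : ℝ) + ∑ p ∈ L', (e p : ℝ) * Real.log p := by
    rw [Rat.cast_natCast, hL', ← Finset.add_sum_erase L _ hp₁L]
  have hΛ' : (e p₁ : ℝ) * Real.log ((p₁ : ℚ) : ℝ) + ∑ p ∈ L', (e p : ℝ) * Real.log p ≠ 0 := by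
    rw [← hsplit]; exact hΛ
  have key := kummer_arch_lower_bound₂ Cw hCw hW₂ L' hL'prime e hβ0 hβ1 hβsq hν (e p₁) hΛ₁
    (fun p hp => hΛL p (hL'sub hp)) hB1 (fun p hp => hBe p (hL'sub hp)) (hBe p₁ hp₁L) hΛ'
  rw [← hsplit, hcard] at key
  -- `h(p₁) = log p₁ ≤ Λ₁`, so `max(h(p₁), Λ₁) = Λ₁`
  haveI : NeZero p₁ := ⟨hp₁.ne_zero⟩
  have hmax : max (logHeight₁ (p₁ : ℚ)) Λ₁ = Λ₁ := by
    rw [Rat.logHeight₁_natCast]; exact max_eq_right (hΛL p₁ hp₁L)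
  rw [hmax] at key
  have hpow : Λ₁ ^ L'.card * Λ₁ = Λ₁ ^ L.card := by rw [← hcard, pow_succ]
  have hexp : L'.card + 2 = L.card + 1 := by omega
  rw [hpow, hexp] at key
  convert key using 2

/-- **The same for `Λ = ∑_{p ∈ L} e_p log p` (no `β₀`)**, `L` a set of at least one prime: the
generators `(p)_{p ∈ L}` alone (distinct primes have independent square classes). Here all
`V_p = Λ₁` and the bound reads
`log |Λ| > −Cw(#L) · Λ₁^{#L} · (log(eB) + log(2Λ₁)) · log(2Λ₁) / (log 2)^{#L+1}`.
[cite: Waldschmidt1980, Prop 3.8 (p. 274)] -/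
theorem kummer_arch_lower_bound_primes (hCw : ∀ n, 0 ≤ Cw n)
    (hW : ∀ (n : ℕ) (α : Fin (n + 1) → ℚ) (b : Fin (n + 1) → ℤ) (V : Fin (n + 1) → ℝ) (W E : ℝ),
      (∀ j, 0 < α j ∧ α j ≠ 1) →
      Module.finrank ℚ ↥(IntermediateField.adjoin ℚ
          (Set.range fun j => Real.sqrt (α j : ℝ))) = 2 ^ (n + 1) →
      Monotone V → 1 ≤ V 0 →
      (∀ j, max (logHeight₁ (α j)) |Real.log (α j : ℝ)| ≤ V j) →
      0 < W → (∀ j, logHeight₁ (b j : ℚ) ≤ W) →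
      1 < E → E ≤ Real.exp (V 0) → (∀ j, E ≤ 4 * V j / |Real.log (α j : ℝ)|) →
      ∑ j, (b j : ℝ) * Real.log (α j : ℝ) ≠ 0 →
      Real.exp (-(Cw (n + 1) * (∏ j, V j) * (W + Real.log (E * V (Fin.last n))) *
          Real.log (E * (if n = 0 then 1 else V ⟨n - 1, by omega⟩)) / Real.log E ^ (n + 2))) <
        |∑ j, (b j : ℝ) * Real.log (α j : ℝ)|)
    (L : Finset ℕ) (hL : ∀ p ∈ L, p.Prime) (hL1 : 1 ≤ L.card) (e : ℕ → ℤ)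
    {Λ₁ : ℝ} (hΛ₁ : 1 ≤ Λ₁) (hΛL : ∀ p ∈ L, Real.log p ≤ Λ₁)
    {B : ℝ} (hB1 : 1 ≤ B) (hBe : ∀ p ∈ L, (|e p| : ℝ) ≤ B)
    (hΛ : ∑ p ∈ L, (e p : ℝ) * Real.log p ≠ 0) :
    -(Cw L.card * Λ₁ ^ L.card * (Real.log (Real.exp 1 * B) + Real.log (2 * Λ₁)) *
        Real.log (2 * Λ₁) / Real.log 2 ^ (L.card + 1)) <
      Real.log |∑ p ∈ L, (e p : ℝ) * Real.log p| :=
  kummer_arch_lower_bound_primes₂ Cw hCw (kummerArchBound_two Cw hW) L hL hL1 e hΛ₁ hΛL hB1 hBe hΛ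

end KummerArch

/-! ### Elementary lemmas for the second regime with the Kummer-conditional bound -/

section RegimeTwoKummerLemmas

/-- `log(2x) ≤ 2x` for `x ≥ 1`. [folklore] -/
theorem log_two_mul_le {x : ℝ} (hx : 1 ≤ x) : Real.log (2 * x) ≤ 2 * x := by
  have := Real.log_le_sub_one_of_pos (show (0 : ℝ) < 2 * x by linarith)
  linarith

/-- `1/(log 2)^n ≤ 2^n`. [folklore] -/
theorem inv_log_two_pow_le (n : ℕ) : 1 / Real.log 2 ^ n ≤ 2 ^ n := by
  have hlog2 : (1 / 2 : ℝ) ≤ Real.log 2 := by have := Real.log_two_gt_d9; linarith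
  have hpos : 0 < Real.log 2 ^ n := pow_pos (by linarith) n
  rw [div_le_iff₀ hpos, ← mul_pow]
  have : (1 : ℝ) ≤ 2 * Real.log 2 := by linarith
  exact one_le_pow₀ this

/-- `log 2 ≤ h(β₀)` for a positive rational `β₀ ≠ 1`. [folklore] -/
theorem log_two_le_logHeight₁ {β₀ : ℚ} (h0 : 0 < β₀) (h1 : β₀ ≠ 1) :
    Real.log 2 ≤ logHeight₁ β₀ := by
  rw [Rat.logHeight₁_eq_log_max]
  exact Real.log_le_log two_pos (by exact_mod_cast two_le_max_numNatAbs_den h0 h1)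

/-- **The logarithms of the second regime are `≪ Λ Y`.** With `G = 6 K J² τ` (`K, J, τ ≥ 1`),
`J ≤ C₁ R^{1/48}`, `τ = R^{1/4}`, `Λ = max(1, log R)`, `Y ≥ 1`, `y ≥ 0` with `log(e(1+3y)) ≤ 4Y`,
`0 ≤ h ≤ G Y` and `D = log 6 + log K + 2 log C₁ + 8`:
`log(e (1+3y)(1+2h)) ≤ D Λ Y` and `log(2 Λ (1 + G Y)) ≤ D Λ Y`. [folklore] -/
theorem regimeIIK_logs {K J τ R Λ Y y h C₁ : ℝ} (hK : 1 ≤ K) (hJ : 1 ≤ J) (hC₁ : 1 ≤ C₁)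
    (hR : 1 ≤ R) (hτ : τ = R ^ (1 / 4 : ℝ)) (hJle : J ≤ C₁ * R ^ (1 / 48 : ℝ))
    (hΛdef : Λ = max 1 (Real.log R)) (hY : 1 ≤ Y) (hy : 0 ≤ y)
    (hlogy : Real.log (Real.exp 1 * (1 + 3 * y)) ≤ 4 * Y) (hh0 : 0 ≤ h)
    (hh : h ≤ 6 * K * J ^ 2 * τ * Y) :
    Real.log (Real.exp 1 * ((1 + 3 * y) * (1 + 2 * h))) ≤
        (Real.log 6 + Real.log K + 2 * Real.log C₁ + 8) * Λ * Y ∧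
      Real.log (2 * (Λ * (1 + 6 * K * J ^ 2 * τ * Y))) ≤
        (Real.log 6 + Real.log K + 2 * Real.log C₁ + 8) * Λ * Y := by
  have hR0 : 0 < R := by linarith
  have hΛ1 : 1 ≤ Λ := by rw [hΛdef]; exact le_max_left _ _
  have hLΛ : Real.log R ≤ Λ := by rw [hΛdef]; exact le_max_right _ _
  have hτ1 : 1 ≤ τ := by rw [hτ]; exact Real.one_le_rpow hR (by norm_num)
  have hJ2 : 1 ≤ J ^ 2 := one_le_pow₀ hJ
  set G : ℝ := 6 * K * J ^ 2 * τ with hG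
  have hG6 : 6 ≤ G := by
    calc (6 : ℝ) = 6 * 1 * 1 * 1 := by ring
      _ ≤ 6 * K * J ^ 2 * τ :=
        mul_le_mul (mul_le_mul (mul_le_mul_of_nonneg_left hK (by norm_num)) hJ2 zero_le_one
          (by positivity)) hτ1 zero_le_one (by positivity)
  have hG0 : 0 < G := by linarith
  have hGY6 : 6 ≤ G * Y := by nlinarith
  set a : ℝ := Real.log 6 + Real.log K + 2 * Real.log C₁ with ha
  have hlogK : 0 ≤ Real.log K := Real.log_nonneg hK
  have hlogC₁ : 0 ≤ Real.log C₁ := Real.log_nonneg hC₁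
  have hlog6 : 1 ≤ Real.log 6 := by
    rw [Real.le_log_iff_exp_le (by norm_num)]
    have := Real.exp_one_lt_d9; linarith
  have ha1 : 1 ≤ a := by rw [ha]; linarith
  -- `log G ≤ (a + 1) Λ`
  have hlogJ : Real.log J ≤ Real.log C₁ + Λ / 48 := by
    have h1 : Real.log J ≤ Real.log (C₁ * R ^ (1 / 48 : ℝ)) :=
      Real.log_le_log (by linarith) hJle
    rw [Real.log_mul (by linarith) (by positivity), Real.log_rpow hR0] at h1
    linarith
  have hlogτ : Real.log τ ≤ Λ / 4 := by
    rw [hτ, Real.log_rpow hR0]; linarith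
  have hlogG : Real.log G ≤ (a + 1) * Λ := by
    have hsplit : Real.log G = Real.log 6 + Real.log K + 2 * Real.log J + Real.log τ := by
      rw [hG, Real.log_mul (by positivity) (by positivity),
        Real.log_mul (by positivity) (by positivity), Real.log_mul (by norm_num) (by positivity),
        Real.log_pow]
      push_cast; ring
    rw [hsplit]
    have : a ≤ a * Λ := le_mul_of_one_le_right (by linarith) hΛ1
    nlinarith
  have hlogY : Real.log Y ≤ Y := (Real.log_le_sub_one_of_pos (by linarith)).trans (by linarith)
  have hlogΛ : Real.log Λ ≤ Λ := (Real.log_le_sub_one_of_pos (by linarith)).trans (by linarith)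
  have hlog3 : Real.log 3 ≤ 2 := by
    have := Real.log_le_sub_one_of_pos (show (0 : ℝ) < 3 by norm_num); linarith
  have hΛY0 : 0 ≤ Λ * Y := by positivity
  have hΛY : 1 ≤ Λ * Y := by nlinarith
  have hΛY' : Λ ≤ Λ * Y := le_mul_of_one_le_right (by linarith) hY
  have hΛY'' : Y ≤ Λ * Y := le_mul_of_one_le_left (by linarith) hΛ1
  have ha0 : 0 ≤ a + 1 := by linarith
  have haΛ : (a + 1) * Λ ≤ (a + 1) * (Λ * Y) := mul_le_mul_of_nonneg_left hΛY' ha0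
  have hexpand : (a + 8) * Λ * Y = (a + 1) * (Λ * Y) + 7 * (Λ * Y) := by ring
  constructor
  · -- `log(e(1+3y)) + log(1 + 2h) ≤ 4Y + log(3 G Y)`
    have h12 : 1 + 2 * h ≤ 3 * (G * Y) := by linarith
    have h12pos : 0 < 1 + 2 * h := by linarith
    have hlog12 : Real.log (1 + 2 * h) ≤ Real.log 3 + Real.log G + Real.log Y := by
      have := Real.log_le_log h12pos h12
      rw [Real.log_mul (by norm_num) (by positivity), Real.log_mul hG0.ne' (by linarith)] at this
      linarith
    have hprod : Real.exp 1 * ((1 + 3 * y) * (1 + 2 * h)) =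
        (Real.exp 1 * (1 + 3 * y)) * (1 + 2 * h) := by ring
    rw [hprod, Real.log_mul (by positivity) h12pos.ne', hexpand]
    linarith
  · -- `log(2Λ(1 + GY)) ≤ log 3 + log Λ + log G + log Y`
    have h1 : 2 * (Λ * (1 + G * Y)) ≤ 3 * Λ * (G * Y) := by nlinarith
    have hpos : 0 < 2 * (Λ * (1 + G * Y)) := by positivity
    have hΛne : Λ ≠ 0 := (show (0 : ℝ) < Λ by linarith).ne'
    have hYne : Y ≠ 0 := (show (0 : ℝ) < Y by linarith).ne'
    have hlog : Real.log (2 * (Λ * (1 + G * Y))) ≤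
        Real.log 3 + Real.log Λ + Real.log G + Real.log Y := by
      have h := Real.log_le_log hpos h1
      have e1 : Real.log (3 * Λ * (G * Y)) =
          Real.log 3 + Real.log Λ + (Real.log G + Real.log Y) := by
        rw [Real.log_mul (mul_ne_zero (by norm_num) hΛne) (mul_ne_zero hG0.ne' hYne),
          Real.log_mul (by norm_num) hΛne, Real.log_mul hG0.ne' hYne]
      linarith [e1]
    rw [hG] at hlog
    rw [hexpand]
    linarith

/-- Arithmetic of the second regime (Kummer version), all sizes `≥ 1`: with
`P = C' D K J² τ Λ⁶`, (i) `1 ≤ P`; (ii) `3 K J² τ Y ≤ 1800 P Y²`; (iii) `4 ≤ 1800 P Y²`;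
(iv) `2 + 2 (192 C' Λ⁵ Y) ≤ 1800 P Y²`;
(v) if `Hs ≤ 1 + 6 K J² τ Y` then `2 + 2 (128 C' D Λ⁶ Hs Y) ≤ 1800 P Y²`. [folklore] -/
theorem regimeIIK_arith {C' D K J τ Λ Y Hs : ℝ} (hC' : 1 ≤ C') (hD : 1 ≤ D) (hK : 1 ≤ K)
    (hJ : 1 ≤ J) (hτ : 1 ≤ τ) (hΛ : 1 ≤ Λ) (hY : 1 ≤ Y) (hHs : Hs ≤ 1 + 6 * K * J ^ 2 * τ * Y) :
    1 ≤ C' * D * K * J ^ 2 * τ * Λ ^ 6 ∧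
    3 * (K * J ^ 2 * τ) * Y ≤ 1800 * (C' * D * K * J ^ 2 * τ * Λ ^ 6) * Y ^ 2 ∧
    (4 : ℝ) ≤ 1800 * (C' * D * K * J ^ 2 * τ * Λ ^ 6) * Y ^ 2 ∧
    2 + 2 * (192 * C' * Λ ^ 5 * Y) ≤ 1800 * (C' * D * K * J ^ 2 * τ * Λ ^ 6) * Y ^ 2 ∧
    2 + 2 * (128 * C' * D * Λ ^ 6 * Hs * Y) ≤ 1800 * (C' * D * K * J ^ 2 * τ * Λ ^ 6) * Y ^ 2 := by
  have hJ2 : 1 ≤ J ^ 2 := one_le_pow₀ hJ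
  have hΛ5 : 1 ≤ Λ ^ 5 := one_le_pow₀ hΛ
  have hΛ6 : 1 ≤ Λ ^ 6 := one_le_pow₀ hΛ
  have hΛ56 : Λ ^ 5 ≤ Λ ^ 6 := pow_le_pow_right₀ hΛ (by norm_num)
  have hY2 : Y ≤ Y ^ 2 := by nlinarith
  have hY21 : 1 ≤ Y ^ 2 := one_le_pow₀ hY
  have hKJτ : 1 ≤ K * J ^ 2 * τ := by
    calc (1 : ℝ) = 1 * 1 * 1 := by ring
      _ ≤ K * J ^ 2 * τ := mul_le_mul (mul_le_mul hK hJ2 zero_le_one (by linarith)) hτ zero_le_one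
          (by positivity)
  have hCD : 1 ≤ C' * D := by nlinarith
  have hCDΛ : 1 ≤ C' * D * Λ ^ 6 := by nlinarith
  set P := C' * D * K * J ^ 2 * τ * Λ ^ 6 with hP
  have hPeq : P = (C' * D * Λ ^ 6) * (K * J ^ 2 * τ) := by rw [hP]; ring
  have hPa : K * J ^ 2 * τ ≤ P := by
    rw [hPeq]; exact le_mul_of_one_le_left (by linarith) hCDΛ
  have hPb : C' * D * Λ ^ 6 ≤ P := by
    rw [hPeq]; exact le_mul_of_one_le_right (by linarith) hKJτ
  have hP1 : 1 ≤ P := hKJτ.trans hPa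
  have hPY : 1 ≤ P * Y ^ 2 := by nlinarith
  have hCΛ5 : C' * Λ ^ 5 ≤ C' * D * Λ ^ 6 := by
    calc C' * Λ ^ 5 = C' * 1 * Λ ^ 5 := by ring
      _ ≤ C' * D * Λ ^ 6 := by
          apply mul_le_mul (mul_le_mul_of_nonneg_left hD (by linarith)) hΛ56 (by positivity)
          positivity
  refine ⟨hP1, ?_, by nlinarith, ?_, ?_⟩
  · have : (K * J ^ 2 * τ) * Y ≤ P * Y ^ 2 := mul_le_mul hPa hY2 (by linarith) (by linarith)
    nlinarith
  · have h1 : C' * Λ ^ 5 * Y ≤ P * Y ^ 2 :=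
      mul_le_mul (hCΛ5.trans hPb) hY2 (by linarith) (by linarith)
    nlinarith
  · have hD0 : 0 ≤ C' * D * Λ ^ 6 := by positivity
    have h1 : 128 * C' * D * Λ ^ 6 * Hs * Y ≤
        128 * C' * D * Λ ^ 6 * (1 + 6 * K * J ^ 2 * τ * Y) * Y := by
      have : 0 ≤ 128 * C' * D * Λ ^ 6 := by positivity
      exact mul_le_mul_of_nonneg_right (mul_le_mul_of_nonneg_left hHs this) (by linarith)
    have h2 : 128 * C' * D * Λ ^ 6 * (1 + 6 * K * J ^ 2 * τ * Y) * Y =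
        128 * (C' * D * Λ ^ 6 * Y) + 768 * P * Y ^ 2 := by rw [hP]; ring
    have h3 : C' * D * Λ ^ 6 * Y ≤ P * Y ^ 2 := mul_le_mul hPb hY2 (by linarith) (by linarith)
    nlinarith

end RegimeTwoKummerLemmas

/-! ### The second regime with the Kummer-conditional archimedean bound -/

section RegimeTwoKummer

variable {K : ℝ} {a b c : ℕ}

set_option maxHeartbeats 800000 in
/-- **Second regime, Kummer version, from the `E = 2` form `hW₂` of the archimedean bound.** For an abc triple with `a ≤ b`, `ab > 1` and `a² < c`:
`log c ≤ 1800 C⋆ D K C₁² · R^{7/24} · Λ⁶ · Y²`, with `Λ = max(1, log R)`, `Y = log max{e, 2 log c}`,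
`C⋆ = max(1, Cw(2), Cw(3), Cw(4))`, `D = log 6 + log K + 2 log C₁ + 8`, `C₁` the constant of
`exists_prod_two_mul_max_log_le`; from the `p`-adic clause (constant `K`) and a lower bound
for linear forms in `≤ 4` logarithms of positive rationals of the shape of Waldschmidt's
Proposition 3.8 (under the `2`-Kummer condition) with ANY constant `Cw(n) ≥ 0`.
Proof: as in `log_le_of_sq_lt` (`log c < 2 + 2 log(1/log(c/b))`, `c/b = β · ∏_{q > R^{1/4}} q^{e_q}`
with `β` the `R^{1/4}`-smooth part, at most three large primes, `h(β) ≤ 6 K J² R^{1/4} Y` paid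
`p`-adically at the small primes), except that the archimedean bound is applied to the
generators `{q > R^{1/4}} ∪ {β₀}` where `β = β₀^{2ʲ}` with `β₀` NOT A SQUARE
(`exists_eq_pow_two_pow_of_pos`): distinct primes and a non-square unit at those primes have
independent square classes, so `[ℚ(√q (q large), √β₀) : ℚ] = 2ⁿ` (`kummer_arch_lower_bound₂`);
the coefficient `2ʲ ≤ 2 h(β)` of `log β₀` and Waldschmidt's two extra logarithmic factors cost
only `log`'s of `R` and `log c` (`regimeIIK_logs`): `Λ⁶ Y²` instead of `Λ³ Y²`.
[cite: StewartYu2001, Theorem 1 (proof), as reconstructed] [cite: Waldschmidt1980, Prop 3.8 (p. 274)] -/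
theorem log_le_of_sq_lt_kummer₂ (hK : 1 ≤ K)
    (hP2 : ∀ (ι : Type) [Fintype ι], 0 < Fintype.card ι →
      ∀ ξ : ι → ℚ, (∀ i, ξ i ≠ 0 ∧ ξ i ≠ 1 ∧ ξ i ≠ -1) →
      ∀ ζ : ℚ, (ζ = 1 ∨ ζ = -1) → ∀ b : ι → ℤ, ζ * ∏ i, ξ i ^ b i ≠ 1 →
      ∀ p : ℕ, p.Prime →
        (padicValRat p (1 - ζ * ∏ i, ξ i ^ b i) : ℝ) * Real.log p <
          K ^ Fintype.card ι * (p / Real.log p) *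
            Real.log (max (Real.exp 1) (p * logHeight₁ (ζ * ∏ i, ξ i ^ b i))) *
            ∏ i, logHeight₁ (ξ i))
    (Cw : ℕ → ℝ) (hCw : ∀ n, 0 ≤ Cw n)
    (hW₂ : ∀ (n : ℕ) (α : Fin (n + 1) → ℚ) (b : Fin (n + 1) → ℤ) (V : Fin (n + 1) → ℝ) (W : ℝ),
      (∀ j, 0 < α j ∧ α j ≠ 1) →
      Module.finrank ℚ ↥(IntermediateField.adjoin ℚ
          (Set.range fun j => Real.sqrt (α j : ℝ))) = 2 ^ (n + 1) →
      Monotone V → 1 ≤ V 0 →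
      (∀ j, max (logHeight₁ (α j)) |Real.log (α j : ℝ)| ≤ V j) →
      0 < W → (∀ j, logHeight₁ (b j : ℚ) ≤ W) →
      ∑ j, (b j : ℝ) * Real.log (α j : ℝ) ≠ 0 →
      Real.exp (-(Cw (n + 1) * (∏ j, V j) * (W + Real.log (2 * V (Fin.last n))) *
          Real.log (2 * (if n = 0 then 1 else V ⟨n - 1, by omega⟩)) / Real.log 2 ^ (n + 2))) <
        |∑ j, (b j : ℝ) * Real.log (α j : ℝ)|)
    {C₁ : ℝ} (hC₁1 : 1 ≤ C₁)
    (hC₁ : ∀ S : Finset ℕ, (∀ p ∈ S, p.Prime) →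
      ∏ p ∈ S, 2 * K * max 1 (Real.log p) ≤ C₁ * (∏ p ∈ S, (p : ℝ)) ^ (1 / 48 : ℝ))
    (h : IsABCTriple a b c) (hab : a ≤ b) (h1 : 1 < a * b) (hac2 : (a : ℝ) ^ 2 < c) :
    Real.log c ≤ 1800 * max 1 (max (max (Cw 2) (Cw 3)) (Cw 4)) *
      (Real.log 6 + Real.log K + 2 * Real.log C₁ + 8) * K * C₁ ^ 2 *
      (rad a b c : ℝ) ^ (7 / 24 : ℝ) * max 1 (Real.log (rad a b c : ℕ)) ^ 6 *
      Real.log (max (Real.exp 1) (2 * Real.log c)) ^ 2 := by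
  classical
  obtain ⟨ha, hb, habc, hcop⟩ := id h
  have hc : c ≠ 0 := by omega
  have hbc : b.Coprime c := coprime_right_of_isABCTriple h
  have hcb : c.Coprime b := hbc.symm
  have hac : a.Coprime c := coprime_left_of_isABCTriple h
  have habc0 : a * b * c ≠ 0 := by positivity
  have hK0 : 0 ≤ K := zero_le_one.trans hK
  have ha_r : (0 : ℝ) < a := by exact_mod_cast ha
  have hb_r : (0 : ℝ) < b := by exact_mod_cast hb
  have hc_r : (0 : ℝ) < c := by exact_mod_cast Nat.pos_of_ne_zero hc
  have hbc_lt : (b : ℝ) < c := by exact_mod_cast (show b < c by omega)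
  have hab_r : (a : ℝ) ≤ b := by exact_mod_cast hab
  -- notation
  set R : ℕ := rad a b c with hRdef
  have hR0n : R ≠ 0 := by
    rw [hRdef, rad_def]; exact UniqueFactorizationMonoid.radical_ne_zero
  have hR1 : (1 : ℝ) ≤ (R : ℝ) := one_le_rad_real a b c
  have hR0 : (0 : ℝ) < R := by linarith
  set Λ : ℝ := max 1 (Real.log (R : ℝ)) with hΛdef
  have hΛ1 : 1 ≤ Λ := le_max_left _ _
  have hΛ0 : 0 < Λ := by linarith
  set τ : ℝ := (R : ℝ) ^ (1 / 4 : ℝ) with hτdef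
  have hτ1 : 1 ≤ τ := Real.one_le_rpow hR1 (by norm_num)
  set y : ℝ := Real.log c with hydef
  have hy0 : 0 < y := Real.log_pos (by exact_mod_cast (show 1 < c by omega))
  set Y : ℝ := Real.log (max (Real.exp 1) (2 * Real.log c)) with hYdef
  have hY1 : 1 ≤ Y := one_le_log_max_exp _
  set Cmax : ℝ := max (max (Cw 2) (Cw 3)) (Cw 4) with hCmax
  set C' : ℝ := max 1 Cmax with hC'
  have hC'1 : 1 ≤ C' := le_max_left _ _
  have hCle : ∀ n, 2 ≤ n → n ≤ 4 → Cw n ≤ C' := fun n hn2 hn4 => by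
    rw [hC', hCmax]; exact apply_le_max_four Cw hn2 hn4
  set D : ℝ := Real.log 6 + Real.log K + 2 * Real.log C₁ + 8 with hDdef
  have hD1 : 1 ≤ D := by
    have h6 : 0 ≤ Real.log 6 := Real.log_nonneg (by norm_num)
    have hK' : 0 ≤ Real.log K := Real.log_nonneg hK
    have hC₁' : 0 ≤ Real.log C₁ := Real.log_nonneg hC₁1
    rw [hDdef]; linarith
  set J : ℝ := ∏ q ∈ (a * b * c).primeFactors, 2 * K * max 1 (Real.log q) with hJdef
  have hJ1 : 1 ≤ J := one_le_prod_two_mul_max hK _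
  have hΘab : theta K a b 0 ≤ K * J :=
    theta_zero_le_mul_prod hK ha.ne' hb.ne' hcop habc0 (Dvd.intro c rfl)
  have hΘac : theta K a c 0 ≤ K * J :=
    theta_zero_le_mul_prod hK ha.ne' hc hac habc0 (Dvd.intro b (by ring))
  have hΘab0 : 0 ≤ theta K a b 0 := theta_nonneg hK0 a b 0
  have hΘac0 : 0 ≤ theta K a c 0 := theta_nonneg hK0 a c 0
  -- `J ≤ C₁ R^{1/48}`
  have hJle : J ≤ C₁ * (R : ℝ) ^ (1 / 48 : ℝ) := by
    have h1' := hC₁ (a * b * c).primeFactors fun q hq => Nat.prime_of_mem_primeFactors hq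
    have hprod : ∏ q ∈ (a * b * c).primeFactors, (q : ℝ) = R := by
      rw [hRdef, rad_def, Nat.radical_eq_prod_primeFactors, Nat.cast_prod]
    rwa [hprod] at h1'
  -- primes of `cb`, small and large
  set P : Finset ℕ := (c * b).primeFactors with hPdef
  have hcbdvd : c * b ∣ a * b * c := Dvd.intro_left a (by ring)
  have hPsub : P ⊆ (a * b * c).primeFactors := Nat.primeFactors_mono hcbdvd habc0
  have hPprime : ∀ q ∈ P, q.Prime := fun q hq => Nat.prime_of_mem_primeFactors hq
  have hcardP : (P.card : ℝ) ≤ J :=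
    le_trans (by exact_mod_cast Finset.card_le_card hPsub) (card_primeFactors_le_prod hK _)
  set S : Finset ℕ := P.filter (fun q => (q : ℝ) ≤ τ) with hSdef
  set L : Finset ℕ := P.filter (fun q => ¬(q : ℝ) ≤ τ) with hLdef
  have hSsub : S ⊆ P := Finset.filter_subset _ _
  have hLsub : L ⊆ P := Finset.filter_subset _ _
  have hSτ : ∀ q ∈ S, (q : ℝ) ≤ τ := fun q hq => (Finset.mem_filter.mp hq).2
  have hLτ : ∀ q ∈ L, τ < q := fun q hq => lt_of_not_ge (Finset.mem_filter.mp hq).2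
  have hLprime : ∀ q ∈ L, q.Prime := fun q hq => hPprime q (hLsub hq)
  have hcardS : (S.card : ℝ) ≤ J :=
    le_trans (by exact_mod_cast Finset.card_le_card hSsub) hcardP
  -- at most three large primes
  have hL3 : L.card ≤ 3 := by
    refine card_le_three_of_quarter_lt hR0n L ?_ hLτ
    have h1' : ∏ q ∈ L, q ∣ ∏ q ∈ (a * b * c).primeFactors, q :=
      Finset.prod_dvd_prod_of_subset _ _ _ (hLsub.trans hPsub)
    rwa [← Nat.radical_eq_prod_primeFactors, ← rad_def] at h1'
  -- `log q ≤ Λ` on `P`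
  have hlogP : ∀ q ∈ P, Real.log q ≤ Λ := by
    intro q hq
    have hqp := hPprime q hq
    have hqR : (q : ℝ) ≤ R := by
      exact_mod_cast prime_le_rad hqp ((Nat.dvd_of_mem_primeFactors hq).trans hcbdvd) habc0
    exact (Real.log_le_log (by exact_mod_cast hqp.pos) hqR).trans (le_max_right _ _)
  -- the smooth part `β` and the splitting of `c/b`
  set e : ℕ → ℤ := expDiff c b with hedef
  set β : ℚ := ∏ q ∈ S, (q : ℚ) ^ e q with hβdef
  have hβpos : 0 < β := Finset.prod_pos fun q hq =>
    zpow_pos (by exact_mod_cast (hPprime q (hSsub hq)).pos) _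
  have hsplitQ : (c : ℚ) / b = β * ∏ q ∈ L, (q : ℚ) ^ e q := by
    rw [cast_div_eq_prod_zpow hc hb.ne' hcb, hβdef, hSdef, hLdef,
      Finset.prod_filter_mul_prod_filter_not]
  set Λ₀ : ℝ := Real.log c - Real.log b with hΛ₀def
  have hΛ₀eq : Λ₀ = Real.log (β : ℝ) + ∑ q ∈ L, (e q : ℝ) * Real.log q := by
    have hcast : (((c : ℚ) / b : ℚ) : ℝ) = (c : ℝ) / b := by push_cast; rfl
    have hq0 : ∀ q ∈ L, ((q : ℝ)) ^ e q ≠ 0 := fun q hq =>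
      zpow_ne_zero _ (by exact_mod_cast (hLprime q hq).ne_zero)
    have h2 : (((c : ℚ) / b : ℚ) : ℝ) = (β : ℝ) * ∏ q ∈ L, (q : ℝ) ^ e q := by
      rw [hsplitQ]; push_cast; rfl
    have hβr : (β : ℝ) ≠ 0 := by exact_mod_cast hβpos.ne'
    have hprod0 : ∏ q ∈ L, (q : ℝ) ^ e q ≠ 0 := Finset.prod_ne_zero_iff.mpr hq0
    calc Λ₀ = Real.log ((c : ℝ) / b) := (Real.log_div hc_r.ne' hb_r.ne').symm
      _ = Real.log ((β : ℝ) * ∏ q ∈ L, (q : ℝ) ^ e q) := by rw [← hcast, h2]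
      _ = Real.log (β : ℝ) + ∑ q ∈ L, Real.log ((q : ℝ) ^ e q) := by
          rw [Real.log_mul hβr hprod0, Real.log_prod hq0]
      _ = Real.log (β : ℝ) + ∑ q ∈ L, (e q : ℝ) * Real.log q := by
          congr 1
          exact Finset.sum_congr rfl fun q _ => Real.log_zpow _ _
  -- `0 < Λ₀ ≤ a/b ≤ 1`
  have hΛ₀pos : 0 < Λ₀ := by
    rw [hΛ₀def]; linarith only [Real.log_lt_log hb_r hbc_lt]
  have hΛ₀le : Λ₀ ≤ (a : ℝ) / b := by
    have h1' : Real.log ((c : ℝ) / b) ≤ (c : ℝ) / b - 1 := Real.log_le_sub_one_of_pos (by positivity)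
    have h2 : (c : ℝ) / b - 1 = (a : ℝ) / b := by
      have : (c : ℝ) = a + b := by exact_mod_cast habc.symm
      rw [this, add_div, div_self hb_r.ne']; ring
    rw [hΛ₀def, ← Real.log_div hc_r.ne' hb_r.ne']
    linarith only [h1', h2]
  have hab1 : (a : ℝ) / b ≤ 1 := (div_le_one hb_r).mpr hab_r
  -- `y < 2 + 2 · (−log Λ₀)`
  have hstar : y < 2 + 2 * (-Real.log Λ₀) := by
    have h2a : 2 * Real.log a < y := by
      have h' : Real.log ((a : ℝ) ^ 2) < Real.log c := Real.log_lt_log (by positivity) hac2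
      have h'' : Real.log ((a : ℝ) ^ 2) = 2 * Real.log a := by
        rw [Real.log_pow]; push_cast; ring
      rw [hydef]; linarith only [h', h'']
    have hlogΛ₀ : Real.log Λ₀ ≤ Real.log a - Real.log b := by
      rw [← Real.log_div ha_r.ne' hb_r.ne']
      exact Real.log_le_log hΛ₀pos hΛ₀le
    have hΛ₀1 : Λ₀ ≤ 1 := hΛ₀le.trans hab1
    have hyΛ : y - Real.log a = Λ₀ + (Real.log b - Real.log a) := by rw [hΛ₀def]; ring
    linarith only [h2a, hlogΛ₀, hΛ₀1, hyΛ]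
  -- exponents: `|e_q| ≤ 1 + 3y`
  set Bₑ : ℝ := 1 + 3 * y with hBₑdef
  have hBₑ1 : 1 ≤ Bₑ := by rw [hBₑdef]; linarith
  have hBₑ : ∀ q ∈ L, (|e q| : ℝ) ≤ Bₑ := by
    intro q hq
    have hqp := hLprime q hq
    have hnat : (|e q| : ℝ) = ((expDiff c b q).natAbs : ℝ) := by
      rw [Nat.cast_natAbs, Int.cast_abs]
    rw [hnat, natAbs_expDiff hc hb.ne' hcb q]
    have h1' := factorization_le_log (mul_ne_zero hc hb.ne') hqp
    have h2 : Real.log ((c * b : ℕ) : ℝ) ≤ 2 * y := by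
      push_cast
      rw [Real.log_mul hc_r.ne' hb_r.ne', hydef]
      linarith only [Real.log_le_log hb_r hbc_lt.le]
    have h3 : (0 : ℝ) ≤ y := hy0.le
    rw [hBₑdef]; linarith only [h1', h2, h3]
  have hlogBₑ : Real.log (Real.exp 1 * Bₑ) ≤ 4 * Y := by
    rw [hBₑdef, hYdef]; exact log_exp_mul_le_four_mul hy0.le
  have he2 : (2 : ℝ) ≤ Real.exp 1 := by have := Real.add_one_le_exp (1 : ℝ); linarith
  have hlogBₑ0 : 0 ≤ Real.log (Real.exp 1 * Bₑ) :=
    Real.log_nonneg (one_le_mul_of_one_le_of_one_le (by linarith) hBₑ1)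
  -- `(log 2)^{-(k+2)} ≤ 32`, `(log 2)^{-(k+1)} ≤ 16` for `k ≤ 3`
  have hlog2 : 0 < Real.log 2 := Real.log_pos one_lt_two
  have hinv : ∀ k, k ≤ 3 → 1 / Real.log 2 ^ (k + 2) ≤ 32 := fun k hk => by
    calc 1 / Real.log 2 ^ (k + 2) ≤ 2 ^ (k + 2) := inv_log_two_pow_le _
      _ ≤ 2 ^ 5 := pow_le_pow_right₀ (by norm_num) (by omega)
      _ = 32 := by norm_num
  have hinv' : ∀ k, k ≤ 3 → 1 / Real.log 2 ^ (k + 1) ≤ 16 := fun k hk => by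
    calc 1 / Real.log 2 ^ (k + 1) ≤ 2 ^ (k + 1) := inv_log_two_pow_le _
      _ ≤ 2 ^ 4 := pow_le_pow_right₀ (by norm_num) (by omega)
      _ = 16 := by norm_num
  have hlog2Λ : Real.log (2 * Λ) ≤ 2 * Λ := log_two_mul_le hΛ1
  have hlog2Λ0 : 0 ≤ Real.log (2 * Λ) := Real.log_nonneg (by linarith)
  have hΛpow : ∀ k, k ≤ 3 → Λ ^ k ≤ Λ ^ 3 := fun k hk => pow_le_pow_right₀ hΛ1 hk
  -- the target of all cases
  set Pₘ : ℝ := C' * D * K * J ^ 2 * τ * Λ ^ 6 with hPₘ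
  set M : ℝ := 1800 * Pₘ with hMdef
  have hMeq : 1800 * (C' * D * K * J ^ 2 * τ * Λ ^ 6) * Y ^ 2 = M * Y ^ 2 := by rw [hMdef]
  have hyM : y ≤ M * Y ^ 2 := by
    rcases Finset.eq_empty_or_nonempty L with hLe | hLne
    · -- every prime of `cb` is small: bound `log c` through the primes of `c` directly
      have hsmall : ∀ q ∈ c.primeFactors, (q : ℝ) ≤ τ := by
        intro q hq
        have hqP : q ∈ P := Nat.primeFactors_mono (Dvd.intro b rfl) (mul_ne_zero hc hb.ne') hq
        by_contra hqτ
        have : q ∈ L := Finset.mem_filter.mpr ⟨hqP, hqτ⟩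
        rw [hLe] at this
        exact Finset.notMem_empty q this
      have h1' := log_le_of_primes_le hK hP2 h h1 hsmall
      have hsubc : c.primeFactors ⊆ (a * b * c).primeFactors :=
        Nat.primeFactors_mono (Dvd.intro_left (a * b) rfl) habc0
      have hcardc : (c.primeFactors.card : ℝ) ≤ J :=
        le_trans (by exact_mod_cast Finset.card_le_card hsubc) (card_primeFactors_le_prod hK _)
      obtain ⟨-, hA2, -, -, -⟩ := regimeIIK_arith (Hs := 1 + 6 * K * J ^ 2 * τ * Y) hC'1 hD1 hK
        hJ1 hτ1 hΛ1 hY1 le_rfl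
      calc y ≤ c.primeFactors.card * (theta K a b 0 * (3 * τ * Y)) := h1'
        _ ≤ J * (K * J * (3 * τ * Y)) := by
            apply mul_le_mul hcardc _ (by positivity) (zero_le_one.trans hJ1)
            exact mul_le_mul_of_nonneg_right hΘab (by positivity)
        _ = 3 * (K * J ^ 2 * τ) * Y := by ring
        _ ≤ 1800 * (C' * D * K * J ^ 2 * τ * Λ ^ 6) * Y ^ 2 := hA2
        _ = M * Y ^ 2 := hMeq
    · rcases eq_or_ne β 1 with hβ1 | hβ1
      · -- `Λ₀ = ∑_{q ∈ L} e_q log q`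
        have hΛ₀eq' : Λ₀ = ∑ q ∈ L, (e q : ℝ) * Real.log q := by
          rw [hΛ₀eq, hβ1]; push_cast; rw [Real.log_one, zero_add]
        rcases le_or_gt 2 L.card with hL2 | hL2
        · have hne : ∑ q ∈ L, (e q : ℝ) * Real.log q ≠ 0 := by rw [← hΛ₀eq']; exact hΛ₀pos.ne'
          have key := kummer_arch_lower_bound_primes₂ Cw hCw hW₂ L hLprime (by omega) e hΛ1
            (fun q hq => hlogP q (hLsub hq)) hBₑ1 hBₑ hne
          rw [← hΛ₀eq', abs_of_pos hΛ₀pos] at key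
          -- `−log Λ₀ < Cw(#L) Λ^{#L} (log(eBₑ) + log 2Λ) log 2Λ / (log 2)^{#L+1} ≤ 192 C' Λ⁵ Y`
          have hCn : Cw L.card ≤ C' := hCle _ hL2 (by omega)
          have hCn0 : 0 ≤ Cw L.card := hCw _
          have hneg : -Real.log Λ₀ ≤ 192 * C' * Λ ^ 5 * Y := by
            have hsum : Real.log (Real.exp 1 * Bₑ) + Real.log (2 * Λ) ≤ 6 * Λ * Y := by
              have h1' : 2 * Λ ≤ 2 * Λ * Y := le_mul_of_one_le_right (by linarith) hY1
              have h2' : Y ≤ Λ * Y := le_mul_of_one_le_left (by linarith) hΛ1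
              have h3' : 6 * Λ * Y = 2 * Λ * Y + 4 * (Λ * Y) := by ring
              linarith only [h1', h2', h3', hlogBₑ, hlog2Λ]
            have hsum0 : 0 ≤ Real.log (Real.exp 1 * Bₑ) + Real.log (2 * Λ) := by linarith
            have h' : Cw L.card * Λ ^ L.card * (Real.log (Real.exp 1 * Bₑ) + Real.log (2 * Λ)) *
                Real.log (2 * Λ) / Real.log 2 ^ (L.card + 1) ≤
                C' * Λ ^ 3 * (6 * Λ * Y) * (2 * Λ) * 16 := by
              rw [div_eq_mul_one_div]
              apply mul_le_mul _ (hinv' _ hL3) (by positivity) (by positivity)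
              apply mul_le_mul _ hlog2Λ hlog2Λ0 (by positivity)
              exact mul_le_mul (mul_le_mul hCn (hΛpow _ hL3) (by positivity) (by positivity))
                hsum hsum0 (by positivity)
            have h'' : C' * Λ ^ 3 * (6 * Λ * Y) * (2 * Λ) * 16 = 192 * C' * Λ ^ 5 * Y := by ring
            linarith only [h', h'', key]
          obtain ⟨-, -, -, hA4, -⟩ := regimeIIK_arith (Hs := 1 + 6 * K * J ^ 2 * τ * Y) hC'1 hD1
            hK hJ1 hτ1 hΛ1 hY1 le_rfl
          calc y ≤ 2 + 2 * (192 * C' * Λ ^ 5 * Y) := by linarith only [hstar, hneg]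
            _ ≤ 1800 * (C' * D * K * J ^ 2 * τ * Λ ^ 6) * Y ^ 2 := hA4
            _ = M * Y ^ 2 := hMeq
        · -- exactly one large prime and `β = 1`: `Λ₀ = e log q₀ ≥ 1/2`
          have hL1 : L.card = 1 := by have := hLne.card_pos; omega
          obtain ⟨q₀, hLq₀⟩ := Finset.card_eq_one.mp hL1
          have hq₀L : q₀ ∈ L := by rw [hLq₀]; exact Finset.mem_singleton_self q₀
          have hq₀p := hLprime q₀ hq₀L
          have hΛ₀q : Λ₀ = (e q₀ : ℝ) * Real.log q₀ := by rw [hΛ₀eq', hLq₀, Finset.sum_singleton]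
          have hlogq₀ : Real.log 2 ≤ Real.log q₀ :=
            Real.log_le_log two_pos (by exact_mod_cast hq₀p.two_le)
          have hlog2' : (1 / 2 : ℝ) < Real.log 2 := by have := Real.log_two_gt_d9; linarith
          have hlogq₀0 : 0 < Real.log q₀ := by linarith only [hlogq₀, hlog2']
          have he1 : (1 : ℝ) ≤ e q₀ := by
            have hpos : (0 : ℝ) < e q₀ := by
              by_contra hle
              push Not at hle
              have h' : Λ₀ ≤ 0 := by rw [hΛ₀q]; exact mul_nonpos_of_nonpos_of_nonneg hle hlogq₀0.le
              linarith only [h', hΛ₀pos]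
            exact_mod_cast (show (1 : ℤ) ≤ e q₀ by exact_mod_cast hpos)
          have hΛ₀ge : 1 / 2 ≤ Λ₀ := by
            rw [hΛ₀q]
            calc (1 / 2 : ℝ) ≤ 1 * Real.log q₀ := by linarith only [hlogq₀, hlog2']
              _ ≤ (e q₀ : ℝ) * Real.log q₀ := mul_le_mul_of_nonneg_right he1 hlogq₀0.le
          have hneg : -Real.log Λ₀ ≤ 1 := by
            have h' : Real.log (1 / 2) ≤ Real.log Λ₀ := Real.log_le_log (by norm_num) hΛ₀ge
            have h12 : Real.log (1 / 2) = -Real.log 2 := by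
              rw [one_div, Real.log_inv]
            have h2 := Real.log_two_lt_d9
            linarith only [h', h12, h2]
          obtain ⟨-, -, hA3, -, -⟩ := regimeIIK_arith (Hs := 1 + 6 * K * J ^ 2 * τ * Y) hC'1 hD1
            hK hJ1 hτ1 hΛ1 hY1 le_rfl
          calc y ≤ 4 := by linarith only [hstar, hneg]
            _ ≤ 1800 * (C' * D * K * J ^ 2 * τ * Λ ^ 6) * Y ^ 2 := hA3
            _ = M * Y ^ 2 := hMeq
      · -- `β ≠ 1`: the archimedean bound with generators `L ∪ {β₀}`, `β = β₀^{2ʲ}`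
        obtain ⟨β₀, j, hβ₀pos, hβ₀1, hβ₀sq, hββ₀⟩ := exists_eq_pow_two_pow_of_pos hβpos hβ1
        -- `log β = 2ʲ log β₀`
        have hlogβ : Real.log (β : ℝ) = ((2 ^ j : ℕ) : ℤ) * Real.log (β₀ : ℝ) := by
          rw [hββ₀, Rat.cast_pow, Real.log_pow]; push_cast; ring
        have hne : ((2 ^ j : ℕ) : ℤ) * Real.log (β₀ : ℝ) + ∑ q ∈ L, (e q : ℝ) * Real.log q ≠ 0 := by
          have : (((2 ^ j : ℕ) : ℤ) : ℝ) * Real.log (β₀ : ℝ) = Real.log (β : ℝ) := by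
            rw [hlogβ]
          rw [this, ← hΛ₀eq]; exact hΛ₀pos.ne'
        -- `β₀` is a unit at the large primes
        have hν : ∀ p ∈ L, padicValRat p β₀ = 0 := by
          intro p hp
          have hpp : p.Prime := hLprime p hp
          haveI : Fact p.Prime := ⟨hpp⟩
          have hpS : p ∉ S := fun hpS => (not_le.mpr (hLτ p hp)) (hSτ p hpS)
          have hvβ : padicValRat p β = 0 := by
            rw [hβdef, padicValRat_finset_prod p S _ (fun q hq =>
              zpow_ne_zero _ (by exact_mod_cast (hPprime q (hSsub hq)).ne_zero))]
            refine Finset.sum_eq_zero fun q hq => ?_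
            have hqp : q.Prime := hPprime q (hSsub hq)
            haveI : Fact q.Prime := ⟨hqp⟩
            have hpq : p ≠ q := fun h => hpS (h ▸ hq)
            rw [padicValRat.zpow, padicValRat.of_nat, padicValNat_primes hpq]
            simp
          rw [hββ₀, padicValRat.pow] at hvβ
          rcases mul_eq_zero.mp hvβ with h0 | h0
          · exact absurd h0 (by positivity)
          · exact h0
        -- heights: `h(β₀) ≤ h(β) ≤ 6 K J² τ Y`, `2ʲ ≤ 2 h(β)`
        set Hs : ℝ := max 1 (logHeight₁ β) with hHsdef
        have hHs1 : 1 ≤ Hs := le_max_left _ _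
        have hhβ := logHeight₁_smooth_le hK hP2 h h1 S hSsub hSτ
        have h6 : logHeight₁ β ≤ 6 * K * J ^ 2 * τ * Y := by
          calc logHeight₁ β ≤ S.card * ((theta K a b 0 + theta K a c 0) * (3 * τ * Y)) := hhβ
            _ ≤ J * ((K * J + K * J) * (3 * τ * Y)) := by
                apply mul_le_mul hcardS _ (by positivity) (zero_le_one.trans hJ1)
                exact mul_le_mul_of_nonneg_right (add_le_add hΘab hΘac) (by positivity)
            _ = 6 * K * J ^ 2 * τ * Y := by ring
        have h60 : 0 ≤ 6 * K * J ^ 2 * τ * Y := by positivity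
        have hh0 : 0 ≤ logHeight₁ β := zero_le_logHeight₁ _
        have hHsle : Hs ≤ 1 + 6 * K * J ^ 2 * τ * Y :=
          max_le (by linarith only [h60]) (by linarith only [h6, hh0])
        have hββ₀h : logHeight₁ β = (2 ^ j : ℕ) * logHeight₁ β₀ := by
          rw [hββ₀, logHeight₁_pow]
        have hh₀pos : Real.log 2 ≤ logHeight₁ β₀ := log_two_le_logHeight₁ hβ₀pos hβ₀1
        have hlog2' : (1 / 2 : ℝ) < Real.log 2 := by have := Real.log_two_gt_d9; linarith
        have h2j : ((2 ^ j : ℕ) : ℝ) ≤ 2 * logHeight₁ β := by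
          rw [hββ₀h]
          have : (0 : ℝ) ≤ (2 ^ j : ℕ) := by positivity
          nlinarith
        have hh₀le : logHeight₁ β₀ ≤ logHeight₁ β := by
          rw [hββ₀h]
          have h1' : (1 : ℝ) ≤ (2 ^ j : ℕ) := by exact_mod_cast Nat.one_le_two_pow
          have : 0 ≤ logHeight₁ β₀ := zero_le_logHeight₁ _
          nlinarith
        -- the coefficients bound `B = Bₑ (1 + 2 h(β))`
        set B : ℝ := Bₑ * (1 + 2 * logHeight₁ β) with hBdef
        have hB1' : 1 ≤ 1 + 2 * logHeight₁ β := by linarith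
        have hB1 : 1 ≤ B := one_le_mul_of_one_le_of_one_le hBₑ1 hB1'
        have hBₑB : Bₑ ≤ B := le_mul_of_one_le_right (by linarith) hB1'
        have hBe : ∀ p ∈ L, (|e p| : ℝ) ≤ B := fun p hp => (hBₑ p hp).trans hBₑB
        have hBm : (|((2 ^ j : ℕ) : ℤ)| : ℝ) ≤ B := by
          have : (|((2 ^ j : ℕ) : ℤ)| : ℝ) = ((2 ^ j : ℕ) : ℝ) := by push_cast; exact abs_of_nonneg (by positivity)
          rw [this]
          calc ((2 ^ j : ℕ) : ℝ) ≤ 1 + 2 * logHeight₁ β := by linarith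
            _ = 1 * (1 + 2 * logHeight₁ β) := (one_mul _).symm
            _ ≤ Bₑ * (1 + 2 * logHeight₁ β) := mul_le_mul_of_nonneg_right hBₑ1 (by linarith)
        have key := kummer_arch_lower_bound₂ Cw hCw hW₂ L hLprime e hβ₀pos hβ₀1 hβ₀sq hν
          ((2 ^ j : ℕ) : ℤ) hΛ1 (fun q hq => hlogP q (hLsub hq)) hB1 hBe hBm hne
        have hΛ₀eq'' : Λ₀ = (((2 ^ j : ℕ) : ℤ) : ℝ) * Real.log (β₀ : ℝ) +
            ∑ q ∈ L, (e q : ℝ) * Real.log q := by rw [hΛ₀eq, hlogβ]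
        rw [← hΛ₀eq'', abs_of_pos hΛ₀pos] at key
        have hL2 : 2 ≤ L.card + 1 := by have := hLne.card_pos; omega
        have hCn : Cw (L.card + 1) ≤ C' := hCle _ hL2 (by omega)
        have hCn0 : 0 ≤ Cw (L.card + 1) := hCw _
        -- the pieces: `H = max(h(β₀), Λ) ≤ Λ Hs`, the logarithms `≤ D Λ Y`
        set H : ℝ := max (logHeight₁ β₀) Λ with hHdef
        have hH1 : 1 ≤ H := hΛ1.trans (le_max_right _ _)
        have hHle : H ≤ Λ * Hs := by
          refine max_le ?_ (le_mul_of_one_le_right hΛ0.le hHs1)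
          calc logHeight₁ β₀ ≤ logHeight₁ β := hh₀le
            _ ≤ Hs := le_max_right _ _
            _ = 1 * Hs := (one_mul _).symm
            _ ≤ Λ * Hs := mul_le_mul_of_nonneg_right hΛ1 (by linarith)
        have hHle' : H ≤ Λ * (1 + 6 * K * J ^ 2 * τ * Y) :=
          hHle.trans (mul_le_mul_of_nonneg_left hHsle hΛ0.le)
        obtain ⟨hlogB, hlogH⟩ := regimeIIK_logs (h := logHeight₁ β) hK hJ1 hC₁1 hR1 rfl hJle rfl
          hY1 hy0.le hlogBₑ hh0 h6
        have hlogB' : Real.log (Real.exp 1 * B) ≤ D * Λ * Y := by rw [hBdef, hBₑdef]; exact hlogB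
        have hlog2H : Real.log (2 * H) ≤ D * Λ * Y := by
          have : Real.log (2 * H) ≤ Real.log (2 * (Λ * (1 + 6 * K * J ^ 2 * τ * Y))) :=
            Real.log_le_log (by linarith) (by linarith)
          exact this.trans hlogH
        have hsum : Real.log (Real.exp 1 * B) + Real.log (2 * H) ≤ 2 * D * Λ * Y := by linarith
        have hsum0 : 0 ≤ Real.log (Real.exp 1 * B) + Real.log (2 * H) := by
          have h1' : 0 ≤ Real.log (Real.exp 1 * B) :=
            Real.log_nonneg (one_le_mul_of_one_le_of_one_le (by linarith) hB1)
          have h2' : 0 ≤ Real.log (2 * H) := Real.log_nonneg (by linarith)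
          linarith
        have hneg : -Real.log Λ₀ ≤ 128 * C' * D * Λ ^ 6 * Hs * Y := by
          have h' : Cw (L.card + 1) * (Λ ^ L.card * H) *
              (Real.log (Real.exp 1 * B) + Real.log (2 * H)) * Real.log (2 * Λ) /
              Real.log 2 ^ (L.card + 2) ≤
              C' * (Λ ^ 3 * (Λ * Hs)) * (2 * D * Λ * Y) * (2 * Λ) * 32 := by
            rw [div_eq_mul_one_div]
            apply mul_le_mul _ (hinv _ hL3) (by positivity) (by positivity)
            apply mul_le_mul _ hlog2Λ hlog2Λ0 (by positivity)
            apply mul_le_mul _ hsum hsum0 (by positivity)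
            exact mul_le_mul hCn (mul_le_mul (hΛpow _ hL3) hHle (by positivity) (by positivity))
              (by positivity) (by positivity)
          have h'' : C' * (Λ ^ 3 * (Λ * Hs)) * (2 * D * Λ * Y) * (2 * Λ) * 32 =
              128 * C' * D * Λ ^ 6 * Hs * Y := by ring
          linarith only [h', h'', key]
        obtain ⟨-, -, -, -, hA5⟩ := regimeIIK_arith hC'1 hD1 hK hJ1 hτ1 hΛ1 hY1 hHsle
        calc y ≤ 2 + 2 * (128 * C' * D * Λ ^ 6 * Hs * Y) := by linarith only [hstar, hneg]
          _ ≤ 1800 * (C' * D * K * J ^ 2 * τ * Λ ^ 6) * Y ^ 2 := hA5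
          _ = M * Y ^ 2 := hMeq
  -- absorb `J² τ ≤ C₁² R^{7/24}`
  have hJ2τ : J ^ 2 * τ ≤ C₁ ^ 2 * (R : ℝ) ^ (7 / 24 : ℝ) := by
    have h48 : ((R : ℝ) ^ (1 / 48 : ℝ)) ^ 2 * (R : ℝ) ^ (1 / 4 : ℝ) = (R : ℝ) ^ (7 / 24 : ℝ) := by
      rw [← Real.rpow_mul_natCast hR0.le, ← Real.rpow_add hR0]; norm_num
    calc J ^ 2 * τ ≤ (C₁ * (R : ℝ) ^ (1 / 48 : ℝ)) ^ 2 * τ :=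
          mul_le_mul_of_nonneg_right (pow_le_pow_left₀ (zero_le_one.trans hJ1) hJle 2)
            (zero_le_one.trans hτ1)
      _ = C₁ ^ 2 * (((R : ℝ) ^ (1 / 48 : ℝ)) ^ 2 * (R : ℝ) ^ (1 / 4 : ℝ)) := by rw [hτdef]; ring
      _ = C₁ ^ 2 * (R : ℝ) ^ (7 / 24 : ℝ) := by rw [h48]
  have hD0 : 0 ≤ D := zero_le_one.trans hD1
  calc y ≤ M * Y ^ 2 := hyM
    _ = 1800 * C' * D * K * (J ^ 2 * τ) * Λ ^ 6 * Y ^ 2 := by rw [hMdef, hPₘ]; ring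
    _ ≤ 1800 * C' * D * K * (C₁ ^ 2 * (R : ℝ) ^ (7 / 24 : ℝ)) * Λ ^ 6 * Y ^ 2 := by
        apply mul_le_mul_of_nonneg_right _ (by positivity)
        apply mul_le_mul_of_nonneg_right _ (by positivity)
        exact mul_le_mul_of_nonneg_left hJ2τ (by positivity)
    _ = 1800 * max 1 (max (max (Cw 2) (Cw 3)) (Cw 4)) *
          (Real.log 6 + Real.log K + 2 * Real.log C₁ + 8) * K * C₁ ^ 2 *
          (rad a b c : ℝ) ^ (7 / 24 : ℝ) * max 1 (Real.log (rad a b c : ℕ)) ^ 6 * Y ^ 2 := by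
        rw [hC', hCmax, hDdef, hΛdef, hRdef]; ring

/-- **Second regime, Kummer version** (the archimedean bound with the parameter `E` free; the
corollary of `log_le_of_sq_lt_kummer₂` through `kummerArchBound_two`). For `a ≤ b`, `ab > 1`, `a² < c`:
`log c ≤ 1800 C⋆ D K C₁² · R^{7/24} · Λ⁶ · Y²`, with `Λ = max(1, log R)`, `Y = log max{e, 2 log c}`,
`C⋆ = max(1, Cw(2), Cw(3), Cw(4))`, `D = log 6 + log K + 2 log C₁ + 8`, `C₁` the constant of
`exists_prod_two_mul_max_log_le`; from the `p`-adic clause (constant `K`) and a lower bound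
for linear forms in `≤ 4` logarithms of positive rationals of the shape of Waldschmidt's
Proposition 3.8 (under the `2`-Kummer condition) with ANY constant `Cw(n) ≥ 0`.
Proof: as in `log_le_of_sq_lt` (`log c < 2 + 2 log(1/log(c/b))`, `c/b = β · ∏_{q > R^{1/4}} q^{e_q}`
with `β` the `R^{1/4}`-smooth part, at most three large primes, `h(β) ≤ 6 K J² R^{1/4} Y` paid
`p`-adically at the small primes), except that the archimedean bound is applied to the
generators `{q > R^{1/4}} ∪ {β₀}` where `β = β₀^{2ʲ}` with `β₀` NOT A SQUARE
(`exists_eq_pow_two_pow_of_pos`): distinct primes and a non-square unit at those primes have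
independent square classes, so `[ℚ(√q (q large), √β₀) : ℚ] = 2ⁿ` (`kummer_arch_lower_bound`);
the coefficient `2ʲ ≤ 2 h(β)` of `log β₀` and Waldschmidt's two extra logarithmic factors cost
only `log`'s of `R` and `log c` (`regimeIIK_logs`): `Λ⁶ Y²` instead of `Λ³ Y²`.
[cite: StewartYu2001, Theorem 1 (proof), as reconstructed] [cite: Waldschmidt1980, Prop 3.8 (p. 274)] -/
theorem log_le_of_sq_lt_kummer (hK : 1 ≤ K)
    (hP2 : ∀ (ι : Type) [Fintype ι], 0 < Fintype.card ι →
      ∀ ξ : ι → ℚ, (∀ i, ξ i ≠ 0 ∧ ξ i ≠ 1 ∧ ξ i ≠ -1) →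
      ∀ ζ : ℚ, (ζ = 1 ∨ ζ = -1) → ∀ b : ι → ℤ, ζ * ∏ i, ξ i ^ b i ≠ 1 →
      ∀ p : ℕ, p.Prime →
        (padicValRat p (1 - ζ * ∏ i, ξ i ^ b i) : ℝ) * Real.log p <
          K ^ Fintype.card ι * (p / Real.log p) *
            Real.log (max (Real.exp 1) (p * logHeight₁ (ζ * ∏ i, ξ i ^ b i))) *
            ∏ i, logHeight₁ (ξ i))
    (Cw : ℕ → ℝ) (hCw : ∀ n, 0 ≤ Cw n)
    (hW : ∀ (n : ℕ) (α : Fin (n + 1) → ℚ) (b : Fin (n + 1) → ℤ) (V : Fin (n + 1) → ℝ) (W E : ℝ),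
      (∀ j, 0 < α j ∧ α j ≠ 1) →
      Module.finrank ℚ ↥(IntermediateField.adjoin ℚ
          (Set.range fun j => Real.sqrt (α j : ℝ))) = 2 ^ (n + 1) →
      Monotone V → 1 ≤ V 0 →
      (∀ j, max (logHeight₁ (α j)) |Real.log (α j : ℝ)| ≤ V j) →
      0 < W → (∀ j, logHeight₁ (b j : ℚ) ≤ W) →
      1 < E → E ≤ Real.exp (V 0) → (∀ j, E ≤ 4 * V j / |Real.log (α j : ℝ)|) →
      ∑ j, (b j : ℝ) * Real.log (α j : ℝ) ≠ 0 →
      Real.exp (-(Cw (n + 1) * (∏ j, V j) * (W + Real.log (E * V (Fin.last n))) *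
          Real.log (E * (if n = 0 then 1 else V ⟨n - 1, by omega⟩)) / Real.log E ^ (n + 2))) <
        |∑ j, (b j : ℝ) * Real.log (α j : ℝ)|)
    {C₁ : ℝ} (hC₁1 : 1 ≤ C₁)
    (hC₁ : ∀ S : Finset ℕ, (∀ p ∈ S, p.Prime) →
      ∏ p ∈ S, 2 * K * max 1 (Real.log p) ≤ C₁ * (∏ p ∈ S, (p : ℝ)) ^ (1 / 48 : ℝ))
    (h : IsABCTriple a b c) (hab : a ≤ b) (h1 : 1 < a * b) (hac2 : (a : ℝ) ^ 2 < c) :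
    Real.log c ≤ 1800 * max 1 (max (max (Cw 2) (Cw 3)) (Cw 4)) *
      (Real.log 6 + Real.log K + 2 * Real.log C₁ + 8) * K * C₁ ^ 2 *
      (rad a b c : ℝ) ^ (7 / 24 : ℝ) * max 1 (Real.log (rad a b c : ℕ)) ^ 6 *
      Real.log (max (Real.exp 1) (2 * Real.log c)) ^ 2 :=
  log_le_of_sq_lt_kummer₂ hK hP2 Cw hCw (kummerArchBound_two Cw hW) hC₁1 hC₁ h hab h1 hac2

end RegimeTwoKummer

/-! ### Endgame with `Λ⁶` and assembly -/

section AssemblyKummer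

variable {K : ℝ}

/-- **Endgame of the second regime, `Λ⁶` version** (pure analysis): if `R ≥ 2`, `M₀ ≥ 1` and
`y ≤ M₀ R^{7/24} Λ⁶ Y²` with `Λ = max(1, log R)`, `Y = log max{e, 2y}`, then
`y ≤ 32·240⁵ · M₀ (log(32M₀) + 7)² · R^{1/3} (log R)³`. [folklore] -/
theorem regimeII_endgame6 {y R M₀ : ℝ} (hM₀ : 1 ≤ M₀) (hR : 2 ≤ R)
    (h : y ≤ M₀ * R ^ (7 / 24 : ℝ) * max 1 (Real.log R) ^ 6 *
      Real.log (max (Real.exp 1) (2 * y)) ^ 2) :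
    y ≤ 32 * 240 ^ 5 * M₀ * (Real.log (32 * M₀) + 7) ^ 2 * R ^ (1 / 3 : ℝ) * Real.log R ^ 3 := by
  set L : ℝ := Real.log R with hL
  set Λ : ℝ := max 1 L
  set M : ℝ := M₀ * R ^ (7 / 24 : ℝ) * Λ ^ 6 with hM
  set c₀ : ℝ := Real.log (32 * M₀) with hc₀
  have hR0 : 0 < R := by linarith
  have hR1 : 1 ≤ R := by linarith
  have hΛ1 : 1 ≤ Λ := le_max_left _ _
  have hΛ0 : 0 < Λ := by linarith
  have hR724 : 1 ≤ R ^ (7 / 24 : ℝ) := Real.one_le_rpow hR1 (by norm_num)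
  have hM1 : 1 ≤ M := by
    calc (1 : ℝ) = 1 * 1 * 1 := by ring
      _ ≤ M₀ * R ^ (7 / 24 : ℝ) * Λ ^ 6 :=
          mul_le_mul (mul_le_mul hM₀ hR724 zero_le_one (by linarith)) (one_le_pow₀ hΛ1)
            zero_le_one (by positivity)
  have h1 : y ≤ 4 * M * Real.log (32 * M) ^ 2 := le_of_le_mul_log_max_sq hM1 (by rw [hM]; linarith)
  -- `log(32M) ≤ (c₀ + 7) Λ`
  have hc₀1 : 1 ≤ c₀ := by
    rw [hc₀, Real.le_log_iff_exp_le (by positivity)]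
    have := Real.exp_one_lt_d9; nlinarith
  have hlogM : Real.log (32 * M) ≤ (c₀ + 7) * Λ := by
    have hsplit : 32 * M = (32 * M₀) * (R ^ (7 / 24 : ℝ) * Λ ^ 6) := by rw [hM]; ring
    have hexp : Real.log (32 * M) = c₀ + 7 / 24 * L + 6 * Real.log Λ := by
      rw [hsplit, Real.log_mul (by positivity) (by positivity),
        Real.log_mul (x := R ^ (7 / 24 : ℝ)) (y := Λ ^ 6) (by positivity) (by positivity),
        Real.log_rpow hR0, Real.log_pow, hc₀]
      push_cast; ring
    have hlogΛ : Real.log Λ ≤ Λ := Real.log_le_self hΛ0.le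
    have hLΛ : L ≤ Λ := le_max_right _ _
    have hc₀Λ : c₀ ≤ c₀ * Λ := le_mul_of_one_le_right (by linarith) hΛ1
    rw [hexp]; nlinarith
  -- `Λ ≤ 240 R^{1/240}` and `Λ ≤ 2 L`
  have hΛ240 : Λ ≤ 240 * R ^ (1 / 240 : ℝ) := by
    refine max_le ?_ ?_
    · have : 1 ≤ R ^ (1 / 240 : ℝ) := Real.one_le_rpow hR1 (by norm_num)
      linarith
    · have := Real.log_le_rpow_div hR0.le (show (0 : ℝ) < 1 / 240 by norm_num)
      rw [hL]; linarith [show R ^ (1 / 240 : ℝ) / (1 / 240) = 240 * R ^ (1 / 240 : ℝ) by ring]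
  have hL2 : Real.log 2 ≤ L := Real.log_le_log two_pos hR
  have hlog2 : (1 / 2 : ℝ) ≤ Real.log 2 := by have := Real.log_two_gt_d9; linarith
  have hL0 : 0 ≤ L := by linarith
  have hΛL : Λ ≤ 2 * L := max_le (by linarith) (by linarith)
  have hΛ5 : Λ ^ 5 ≤ 240 ^ 5 * R ^ (1 / 24 : ℝ) := by
    have h5 : (R ^ (1 / 240 : ℝ)) ^ 5 = R ^ (1 / 48 : ℝ) := by
      rw [← Real.rpow_mul_natCast hR0.le]; norm_num
    have h48 : R ^ (1 / 48 : ℝ) ≤ R ^ (1 / 24 : ℝ) :=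
      Real.rpow_le_rpow_of_exponent_le hR1 (by norm_num)
    calc Λ ^ 5 ≤ (240 * R ^ (1 / 240 : ℝ)) ^ 5 := pow_le_pow_left₀ hΛ0.le hΛ240 5
      _ = 240 ^ 5 * R ^ (1 / 48 : ℝ) := by rw [mul_pow, h5]
      _ ≤ 240 ^ 5 * R ^ (1 / 24 : ℝ) := mul_le_mul_of_nonneg_left h48 (by positivity)
  have hΛ3 : Λ ^ 3 ≤ 8 * L ^ 3 := by
    calc Λ ^ 3 ≤ (2 * L) ^ 3 := pow_le_pow_left₀ hΛ0.le hΛL 3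
      _ = 8 * L ^ 3 := by ring
  have hRR : R ^ (7 / 24 : ℝ) * R ^ (1 / 24 : ℝ) = R ^ (1 / 3 : ℝ) := by
    rw [← Real.rpow_add hR0]; norm_num
  -- assemble
  have hc7 : 0 ≤ c₀ + 7 := by linarith
  calc y ≤ 4 * M * Real.log (32 * M) ^ 2 := h1
    _ ≤ 4 * M * ((c₀ + 7) * Λ) ^ 2 := by
        apply mul_le_mul_of_nonneg_left _ (by positivity)
        exact pow_le_pow_left₀ (by linarith [Real.log_nonneg (show (1:ℝ) ≤ 32 * M by linarith)]) hlogM 2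
    _ = 4 * M₀ * (c₀ + 7) ^ 2 * R ^ (7 / 24 : ℝ) * Λ ^ 3 * Λ ^ 5 := by rw [hM]; ring
    _ ≤ 4 * M₀ * (c₀ + 7) ^ 2 * R ^ (7 / 24 : ℝ) * (8 * L ^ 3) * (240 ^ 5 * R ^ (1 / 24 : ℝ)) := by
        apply mul_le_mul _ hΛ5 (by positivity) (by positivity)
        exact mul_le_mul_of_nonneg_left hΛ3 (by positivity)
    _ = 32 * 240 ^ 5 * M₀ * (c₀ + 7) ^ 2 * (R ^ (7 / 24 : ℝ) * R ^ (1 / 24 : ℝ)) * L ^ 3 := by ring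
    _ = 32 * 240 ^ 5 * M₀ * (c₀ + 7) ^ 2 * R ^ (1 / 3 : ℝ) * L ^ 3 := by rw [hRR]

/-- **Stewart–Yu's `(1/3, 3)` from the `p`-adic clause and the `E = 2` form of a Kummer-conditional
archimedean bound with an arbitrary constant.** If the `p`-adic clause of Pasten's approximation bound holds
with some absolute `K ≥ 1`, and linear forms in `≤ 4` logarithms of positive rationals
satisfying the `2`-Kummer condition admit ANY lower bound of the shape of Waldschmidt's
Proposition 3.8 (`log |Λ| > −Cw(n) V₁⋯Vₙ (W + log(EVₙ)) log(EV⁺ₙ₋₁) (log E)^{-n-1}`, no condition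
on the constants `Cw(n) ≥ 0`), then `BakerShapeBound (1/3) 3`: `log c ≤ κ R^{1/3} (log R)³` for
all abc triples. Proof: w.l.o.g. `a ≤ b`; the triple `1 + 1 = 2` directly; if `c ≤ a²`, the cube
of the three `p`-adic routes (`log_le_of_le_sq`, no archimedean input); if `a² < c`, the Kummer
second regime (`log_le_of_sq_lt_kummer₂`, `regimeII_endgame6`).
[cite: StewartYu2001, Theorem 1] [cite: Waldschmidt1980, Prop 3.8 (p. 274)] -/
theorem bakerShapeBound_third_three_of_padicClause_kummerArchBound₂ (hK : 1 ≤ K)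
    (hP2 : ∀ (ι : Type) [Fintype ι], 0 < Fintype.card ι →
      ∀ ξ : ι → ℚ, (∀ i, ξ i ≠ 0 ∧ ξ i ≠ 1 ∧ ξ i ≠ -1) →
      ∀ ζ : ℚ, (ζ = 1 ∨ ζ = -1) → ∀ b : ι → ℤ, ζ * ∏ i, ξ i ^ b i ≠ 1 →
      ∀ p : ℕ, p.Prime →
        (padicValRat p (1 - ζ * ∏ i, ξ i ^ b i) : ℝ) * Real.log p <
          K ^ Fintype.card ι * (p / Real.log p) *
            Real.log (max (Real.exp 1) (p * logHeight₁ (ζ * ∏ i, ξ i ^ b i))) *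
            ∏ i, logHeight₁ (ξ i))
    (Cw : ℕ → ℝ) (hCw : ∀ n, 0 ≤ Cw n)
    (hW₂ : ∀ (n : ℕ) (α : Fin (n + 1) → ℚ) (b : Fin (n + 1) → ℤ) (V : Fin (n + 1) → ℝ) (W : ℝ),
      (∀ j, 0 < α j ∧ α j ≠ 1) →
      Module.finrank ℚ ↥(IntermediateField.adjoin ℚ
          (Set.range fun j => Real.sqrt (α j : ℝ))) = 2 ^ (n + 1) →
      Monotone V → 1 ≤ V 0 →
      (∀ j, max (logHeight₁ (α j)) |Real.log (α j : ℝ)| ≤ V j) →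
      0 < W → (∀ j, logHeight₁ (b j : ℚ) ≤ W) →
      ∑ j, (b j : ℝ) * Real.log (α j : ℝ) ≠ 0 →
      Real.exp (-(Cw (n + 1) * (∏ j, V j) * (W + Real.log (2 * V (Fin.last n))) *
          Real.log (2 * (if n = 0 then 1 else V ⟨n - 1, by omega⟩)) / Real.log 2 ^ (n + 2))) <
        |∑ j, (b j : ℝ) * Real.log (α j : ℝ)|) :
    BakerShapeBound (1 / 3) 3 := by
  obtain ⟨Ca, hCa1, hCa⟩ := exists_prod_mul_log_sq_div_le (show (0 : ℝ) ≤ 4 * K ^ 2 by positivity)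
  obtain ⟨C₁, hC₁1, hC₁⟩ := exists_prod_two_mul_max_log_le (zero_le_one.trans hK)
  set κ₁ : ℝ := 64 * K ^ 3 * (2 * Ca) * (Real.log (16 * K ^ 3 * (2 * Ca)) + 3) with hκ₁
  set M₀ : ℝ := 1800 * max 1 (max (max (Cw 2) (Cw 3)) (Cw 4)) *
    (Real.log 6 + Real.log K + 2 * Real.log C₁ + 8) * K * C₁ ^ 2 with hM₀
  set κ₂ : ℝ := 32 * 240 ^ 5 * M₀ * (Real.log (32 * M₀) + 7) ^ 2 with hκ₂
  have hK3 : 1 ≤ K ^ 3 := one_le_pow₀ hK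
  have hCa2 : 1 ≤ 2 * Ca := by linarith
  have hc₀0 : 0 ≤ Real.log (16 * K ^ 3 * (2 * Ca)) := Real.log_nonneg (by nlinarith)
  have hκ₁192 : (192 : ℝ) ≤ κ₁ := by
    have h3 : (3 : ℝ) ≤ Real.log (16 * K ^ 3 * (2 * Ca)) + 3 := by linarith
    calc (192 : ℝ) = 64 * 1 * 1 * 3 := by norm_num
      _ ≤ 64 * K ^ 3 * (2 * Ca) * (Real.log (16 * K ^ 3 * (2 * Ca)) + 3) :=
          mul_le_mul (mul_le_mul (mul_le_mul_of_nonneg_left hK3 (by norm_num)) hCa2 zero_le_one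
            (by positivity)) h3 (by norm_num) (by positivity)
  have hD1 : 1 ≤ Real.log 6 + Real.log K + 2 * Real.log C₁ + 8 := by
    have h6 : 0 ≤ Real.log 6 := Real.log_nonneg (by norm_num)
    have hK' : 0 ≤ Real.log K := Real.log_nonneg hK
    have hC₁' : 0 ≤ Real.log C₁ := Real.log_nonneg hC₁1
    linarith
  have hM₀1 : 1 ≤ M₀ := by
    have h1 : (1 : ℝ) ≤ max 1 (max (max (Cw 2) (Cw 3)) (Cw 4)) := le_max_left _ _
    have h2 : (1 : ℝ) ≤ C₁ ^ 2 := one_le_pow₀ hC₁1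
    calc (1 : ℝ) ≤ 1800 * 1 * 1 * 1 * 1 := by norm_num
      _ ≤ 1800 * max 1 (max (max (Cw 2) (Cw 3)) (Cw 4)) *
          (Real.log 6 + Real.log K + 2 * Real.log C₁ + 8) * K * C₁ ^ 2 :=
          mul_le_mul (mul_le_mul (mul_le_mul (mul_le_mul_of_nonneg_left h1 (by norm_num)) hD1
            zero_le_one (by positivity)) hK zero_le_one (by positivity)) h2 zero_le_one
            (by positivity)
  have hκ₂0 : 0 ≤ κ₂ := by
    have : 0 ≤ M₀ := zero_le_one.trans hM₀1
    positivity
  -- w.l.o.g. `a ≤ b`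
  suffices key : ∀ a b c : ℕ, IsABCTriple a b c → a ≤ b →
      Real.log c ≤ max κ₁ κ₂ * (rad a b c : ℝ) ^ (1 / 3 : ℝ) * Real.log (rad a b c : ℕ) ^ 3 by
    refine ⟨max κ₁ κ₂, fun a b c h => ?_⟩
    rcases le_total a b with hab | hba
    · exact key a b c h hab
    · have := key b a c h.swap hba
      rwa [rad_swap] at this
  intro a b c h hab
  obtain ⟨ha, hb, habc, hcop⟩ := id h
  have hR2 : (2 : ℝ) ≤ (rad a b c : ℝ) := by
    have : 2 ≤ rad a b c := by
      rw [rad_def, Nat.two_le_radical_iff]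
      calc 2 ≤ c := by omega
        _ ≤ a * b * c := Nat.le_mul_of_pos_left c (Nat.mul_pos ha hb)
    exact_mod_cast this
  set R : ℝ := ((rad a b c : ℕ) : ℝ) with hR
  have hlogR : 0 ≤ Real.log R := Real.log_nonneg (by linarith)
  have hRL : 0 ≤ R ^ (1 / 3 : ℝ) * Real.log R ^ 3 := by positivity
  by_cases h1 : 1 < a * b
  · rcases le_or_gt (c : ℝ) ((a : ℝ) ^ 2) with hca | hac2
    · -- first regime: `p`-adic routes only
      have h' := log_le_of_le_sq hK hP2 hCa1 hCa h hab hca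
      calc Real.log c ≤ κ₁ * R ^ (1 / 3 : ℝ) * Real.log R ^ 3 := h'
        _ = κ₁ * (R ^ (1 / 3 : ℝ) * Real.log R ^ 3) := by ring
        _ ≤ max κ₁ κ₂ * (R ^ (1 / 3 : ℝ) * Real.log R ^ 3) :=
            mul_le_mul_of_nonneg_right (le_max_left _ _) hRL
        _ = max κ₁ κ₂ * R ^ (1 / 3 : ℝ) * Real.log R ^ 3 := by ring
    · -- second regime, Kummer version
      have h' := log_le_of_sq_lt_kummer₂ hK hP2 Cw hCw hW₂ hC₁1 hC₁ h hab h1 hac2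
      have h'' : Real.log c ≤ M₀ * R ^ (7 / 24 : ℝ) * max 1 (Real.log R) ^ 6 *
          Real.log (max (Real.exp 1) (2 * Real.log c)) ^ 2 := by
        rw [hM₀]; exact h'
      have h3 := regimeII_endgame6 hM₀1 hR2 h''
      calc Real.log c ≤ κ₂ * R ^ (1 / 3 : ℝ) * Real.log R ^ 3 := by rw [hκ₂]; exact h3
        _ = κ₂ * (R ^ (1 / 3 : ℝ) * Real.log R ^ 3) := by ring
        _ ≤ max κ₁ κ₂ * (R ^ (1 / 3 : ℝ) * Real.log R ^ 3) :=
            mul_le_mul_of_nonneg_right (le_max_right _ _) hRL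
        _ = max κ₁ κ₂ * R ^ (1 / 3 : ℝ) * Real.log R ^ 3 := by ring
  · -- the triple `1 + 1 = 2`
    have hab1 : a * b = 1 := by
      have : 1 ≤ a * b := Nat.mul_pos ha hb
      omega
    have ha1 : a = 1 := Nat.eq_one_of_mul_eq_one_right hab1
    have hb1 : b = 1 := Nat.eq_one_of_mul_eq_one_left hab1
    have hc2 : c = 2 := by omega
    have hκ : (192 : ℝ) ≤ max κ₁ κ₂ := hκ₁192.trans (le_max_left _ _)
    have hR13 : 1 ≤ R ^ (1 / 3 : ℝ) := Real.one_le_rpow (by linarith) (by norm_num)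
    have hL : (0.69 : ℝ) ≤ Real.log R :=
      le_trans (by have := Real.log_two_gt_d9; linarith) (Real.log_le_log two_pos hR2)
    have hL3 : (0.69 : ℝ) ^ 3 ≤ Real.log R ^ 3 := pow_le_pow_left₀ (by norm_num) hL 3
    have hlog2 : Real.log 2 ≤ 0.7 := by have := Real.log_two_lt_d9; linarith
    calc Real.log c = Real.log 2 := by rw [hc2]; norm_num
      _ ≤ 0.7 := hlog2
      _ ≤ 192 * 1 * (0.69 : ℝ) ^ 3 := by norm_num
      _ ≤ max κ₁ κ₂ * R ^ (1 / 3 : ℝ) * Real.log R ^ 3 :=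
          mul_le_mul (mul_le_mul hκ hR13 zero_le_one (by linarith)) hL3 (by norm_num)
            (by positivity)

/-- **Stewart–Yu's `(1/3, 3)` from the `p`-adic clause and a Kummer-conditional archimedean
bound with an arbitrary constant.** If the `p`-adic clause of Pasten's approximation bound holds
with some absolute `K ≥ 1`, and linear forms in `≤ 4` logarithms of positive rationals
satisfying the `2`-Kummer condition admit ANY lower bound of the shape of Waldschmidt's
Proposition 3.8 (`log |Λ| > −Cw(n) V₁⋯Vₙ (W + log(EVₙ)) log(EV⁺ₙ₋₁) (log E)^{-n-1}`, no condition
on the constants `Cw(n) ≥ 0`), then `BakerShapeBound (1/3) 3`: `log c ≤ κ R^{1/3} (log R)³` for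
all abc triples. Proof: w.l.o.g. `a ≤ b`; the triple `1 + 1 = 2` directly; if `c ≤ a²`, the cube
of the three `p`-adic routes (`log_le_of_le_sq`, no archimedean input); if `a² < c`, the Kummer
second regime (`log_le_of_sq_lt_kummer`, `regimeII_endgame6`).
[cite: StewartYu2001, Theorem 1] [cite: Waldschmidt1980, Prop 3.8 (p. 274)] -/
theorem bakerShapeBound_third_three_of_padicClause_kummerArchBound (hK : 1 ≤ K)
    (hP2 : ∀ (ι : Type) [Fintype ι], 0 < Fintype.card ι →
      ∀ ξ : ι → ℚ, (∀ i, ξ i ≠ 0 ∧ ξ i ≠ 1 ∧ ξ i ≠ -1) →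
      ∀ ζ : ℚ, (ζ = 1 ∨ ζ = -1) → ∀ b : ι → ℤ, ζ * ∏ i, ξ i ^ b i ≠ 1 →
      ∀ p : ℕ, p.Prime →
        (padicValRat p (1 - ζ * ∏ i, ξ i ^ b i) : ℝ) * Real.log p <
          K ^ Fintype.card ι * (p / Real.log p) *
            Real.log (max (Real.exp 1) (p * logHeight₁ (ζ * ∏ i, ξ i ^ b i))) *
            ∏ i, logHeight₁ (ξ i))
    (Cw : ℕ → ℝ) (hCw : ∀ n, 0 ≤ Cw n)
    (hW : ∀ (n : ℕ) (α : Fin (n + 1) → ℚ) (b : Fin (n + 1) → ℤ) (V : Fin (n + 1) → ℝ) (W E : ℝ),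
      (∀ j, 0 < α j ∧ α j ≠ 1) →
      Module.finrank ℚ ↥(IntermediateField.adjoin ℚ
          (Set.range fun j => Real.sqrt (α j : ℝ))) = 2 ^ (n + 1) →
      Monotone V → 1 ≤ V 0 →
      (∀ j, max (logHeight₁ (α j)) |Real.log (α j : ℝ)| ≤ V j) →
      0 < W → (∀ j, logHeight₁ (b j : ℚ) ≤ W) →
      1 < E → E ≤ Real.exp (V 0) → (∀ j, E ≤ 4 * V j / |Real.log (α j : ℝ)|) →
      ∑ j, (b j : ℝ) * Real.log (α j : ℝ) ≠ 0 →
      Real.exp (-(Cw (n + 1) * (∏ j, V j) * (W + Real.log (E * V (Fin.last n))) *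
          Real.log (E * (if n = 0 then 1 else V ⟨n - 1, by omega⟩)) / Real.log E ^ (n + 2))) <
        |∑ j, (b j : ℝ) * Real.log (α j : ℝ)|) :
    BakerShapeBound (1 / 3) 3 :=
  bakerShapeBound_third_three_of_padicClause_kummerArchBound₂ hK hP2 Cw hCw (kummerArchBound_two Cw hW)

/-- **`BakerMethodBounds` from the `p`-adic clause (constant `K ≥ 1`) and a Kummer-conditional
archimedean bound with an arbitrary constant** (`BakerMethodBounds = BakerShapeBound (1/3) 3` by
definition). [cite: StewartYu2001, Theorem 1] [cite: Waldschmidt1980, Prop 3.8 (p. 274)] -/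
theorem BakerMethodBounds_of_padicClause_kummerArchBound (hK : 1 ≤ K)
    (hP2 : ∀ (ι : Type) [Fintype ι], 0 < Fintype.card ι →
      ∀ ξ : ι → ℚ, (∀ i, ξ i ≠ 0 ∧ ξ i ≠ 1 ∧ ξ i ≠ -1) →
      ∀ ζ : ℚ, (ζ = 1 ∨ ζ = -1) → ∀ b : ι → ℤ, ζ * ∏ i, ξ i ^ b i ≠ 1 →
      ∀ p : ℕ, p.Prime →
        (padicValRat p (1 - ζ * ∏ i, ξ i ^ b i) : ℝ) * Real.log p <
          K ^ Fintype.card ι * (p / Real.log p) *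
            Real.log (max (Real.exp 1) (p * logHeight₁ (ζ * ∏ i, ξ i ^ b i))) *
            ∏ i, logHeight₁ (ξ i))
    (Cw : ℕ → ℝ) (hCw : ∀ n, 0 ≤ Cw n)
    (hW : ∀ (n : ℕ) (α : Fin (n + 1) → ℚ) (b : Fin (n + 1) → ℤ) (V : Fin (n + 1) → ℝ) (W E : ℝ),
      (∀ j, 0 < α j ∧ α j ≠ 1) →
      Module.finrank ℚ ↥(IntermediateField.adjoin ℚ
          (Set.range fun j => Real.sqrt (α j : ℝ))) = 2 ^ (n + 1) →
      Monotone V → 1 ≤ V 0 →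
      (∀ j, max (logHeight₁ (α j)) |Real.log (α j : ℝ)| ≤ V j) →
      0 < W → (∀ j, logHeight₁ (b j : ℚ) ≤ W) →
      1 < E → E ≤ Real.exp (V 0) → (∀ j, E ≤ 4 * V j / |Real.log (α j : ℝ)|) →
      ∑ j, (b j : ℝ) * Real.log (α j : ℝ) ≠ 0 →
      Real.exp (-(Cw (n + 1) * (∏ j, V j) * (W + Real.log (E * V (Fin.last n))) *
          Real.log (E * (if n = 0 then 1 else V ⟨n - 1, by omega⟩)) / Real.log E ^ (n + 2))) <
        |∑ j, (b j : ℝ) * Real.log (α j : ℝ)|) :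
    BakerMethodBounds :=
  bakerShapeBound_third_three_of_padicClause_kummerArchBound hK hP2 Cw hCw hW

/-- **`BakerMethodBounds` from Evertse–Győry's Theorem 3.2.8 over `ℚ` at the FINITE places only,
plus a Kummer-conditional archimedean bound with an arbitrary constant.** The hypothesis `h328`
is the finite-place half of the printed Theorem 3.2.8 for `K = ℚ` (as in
`Dioph.evertseGyory_thm_4_2_1_rat_of_thm_3_2_8`, and as PRODUCED by `Dioph.thm328_rat_finite_of_yu`
from Yu's Theorem 3.2.7 over `ℚ`).
[cite: StewartYu2001, Theorem 1] [cite: EvertseGyory2015, Thm 3.2.8 (p. 62)]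
[cite: Waldschmidt1980, Prop 3.8 (p. 274)] -/
theorem BakerMethodBounds_of_thm328Finite_kummerArchBound
    (h328 : ∀ (ι : Type) [Fintype ι], 0 < Fintype.card ι →
      ∀ α : ι → ℚ, (∀ i, α i ≠ 0 ∧ α i ≠ 1 ∧ α i ≠ -1) →
      ∀ β : ℚ, β ≠ 0 → ∀ s : ℤ, (s = 1 ∨ s = -1) → ∀ b : ι → ℤ,
        (∏ i, α i ^ b i) * β ^ s - 1 ≠ 0 →
      ∀ B : ℝ, (∀ i, (|b i| : ℝ) ≤ B) →
        2 * Real.exp 1 * 9 ^ (Fintype.card ι + 1) * (∏ i, logHeight₁ (α i)) *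
            max (logHeight₁ β) 1 ≤ B →
        ∀ p : ℕ, p.Prime →
          -(egC6 (Fintype.card ι + 1) * (p / Real.log p) * (∏ i, logHeight₁ (α i)) *
              max (logHeight₁ β) 1 * logStar (B * p / max (logHeight₁ β) 1)) <
            -(padicValRat p ((∏ i, α i ^ b i) * β ^ s - 1) : ℝ) * Real.log p)
    (Cw : ℕ → ℝ) (hCw : ∀ n, 0 ≤ Cw n)
    (hW : ∀ (n : ℕ) (α : Fin (n + 1) → ℚ) (b : Fin (n + 1) → ℤ) (V : Fin (n + 1) → ℝ) (W E : ℝ),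
      (∀ j, 0 < α j ∧ α j ≠ 1) →
      Module.finrank ℚ ↥(IntermediateField.adjoin ℚ
          (Set.range fun j => Real.sqrt (α j : ℝ))) = 2 ^ (n + 1) →
      Monotone V → 1 ≤ V 0 →
      (∀ j, max (logHeight₁ (α j)) |Real.log (α j : ℝ)| ≤ V j) →
      0 < W → (∀ j, logHeight₁ (b j : ℚ) ≤ W) →
      1 < E → E ≤ Real.exp (V 0) → (∀ j, E ≤ 4 * V j / |Real.log (α j : ℝ)|) →
      ∑ j, (b j : ℝ) * Real.log (α j : ℝ) ≠ 0 →
      Real.exp (-(Cw (n + 1) * (∏ j, V j) * (W + Real.log (E * V (Fin.last n))) *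
          Real.log (E * (if n = 0 then 1 else V ⟨n - 1, by omega⟩)) / Real.log E ^ (n + 2))) <
        |∑ j, (b j : ℝ) * Real.log (α j : ℝ)|) :
    BakerMethodBounds :=
  BakerMethodBounds_of_padicClause_kummerArchBound one_le_pastenK (padicClause_of_thm328_finite h328)
    Cw hCw hW

/-- **`BakerMethodBounds` from Yu's Theorem 3.2.7 over `ℚ` as printed (Yu 2007) and a
Kummer-conditional archimedean bound with an arbitrary constant** — so the archimedean input of
the Stewart–Yu bound may be Waldschmidt's 1980 Proposition 3.8 for `K = ℚ`, `q = 2` (Baker's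
method with a `2`-descent; no zero estimate, no geometry of numbers), instead of the theorems of
Baker–Wüstholz 1993 or Matveev 2000. The hypothesis `hY` is verbatim that of
`Dioph.thm328_rat_finite_of_yu`. [cite: StewartYu2001, Theorem 1]
[cite: EvertseGyory2015, Thm 3.2.7 (p. 62)] [cite: Waldschmidt1980, Prop 3.8 (p. 274)] -/
theorem BakerMethodBounds_of_yu_kummerArchBound
    (hY : ∀ (κ : Type) [Fintype κ] [DecidableEq κ], 2 ≤ Fintype.card κ →
      ∀ (α : κ → ℚ) (b : κ → ℤ) (k₀ : κ) (B Bn δ : ℝ) (p : ℕ), p.Prime →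
        (∀ k, α k ≠ 0) → b k₀ ≠ 0 →
        (∀ k, b k ≠ 0 → padicValInt p (b k₀) ≤ padicValInt p (b k)) →
        (∀ k, (|b k| : ℝ) ≤ B) → Bn ≤ B → (|b k₀| : ℝ) ≤ Bn →
        ∏ k, α k ^ b k - 1 ≠ 0 → 0 < δ → δ ≤ 1 / 2 →
        (padicValRat p (∏ k, α k ^ b k - 1) : ℝ) <
          (16 * Real.exp 1) ^ (2 * (Fintype.card κ + 1)) * (Fintype.card κ : ℝ) ^ (3 / 2 : ℝ) *
              Real.log (2 * Fintype.card κ) * Real.log 2 *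
            (p / Real.log p ^ 2) *
            max ((∏ k, max (logHeight₁ (α k)) (1 / (16 * Real.exp 1 ^ 2))) *
                  Real.log (Bn * (2 * Real.exp 1 ^ ((Fintype.card κ + 1) *
                      (6 * Fintype.card κ + 5)) * Real.log 2) * (p : ℝ) ^ (Fintype.card κ + 1) *
                    (∏ k ∈ univ.erase k₀, max (logHeight₁ (α k)) (1 / (16 * Real.exp 1 ^ 2))) /
                    δ))
              (δ * B / (Bn * (2 ^ (2 * Fintype.card κ + 1) * Real.log 2 * Real.log 3 ^ 3))))
    (Cw : ℕ → ℝ) (hCw : ∀ n, 0 ≤ Cw n)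
    (hW : ∀ (n : ℕ) (α : Fin (n + 1) → ℚ) (b : Fin (n + 1) → ℤ) (V : Fin (n + 1) → ℝ) (W E : ℝ),
      (∀ j, 0 < α j ∧ α j ≠ 1) →
      Module.finrank ℚ ↥(IntermediateField.adjoin ℚ
          (Set.range fun j => Real.sqrt (α j : ℝ))) = 2 ^ (n + 1) →
      Monotone V → 1 ≤ V 0 →
      (∀ j, max (logHeight₁ (α j)) |Real.log (α j : ℝ)| ≤ V j) →
      0 < W → (∀ j, logHeight₁ (b j : ℚ) ≤ W) →
      1 < E → E ≤ Real.exp (V 0) → (∀ j, E ≤ 4 * V j / |Real.log (α j : ℝ)|) →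
      ∑ j, (b j : ℝ) * Real.log (α j : ℝ) ≠ 0 →
      Real.exp (-(Cw (n + 1) * (∏ j, V j) * (W + Real.log (E * V (Fin.last n))) *
          Real.log (E * (if n = 0 then 1 else V ⟨n - 1, by omega⟩)) / Real.log E ^ (n + 2))) <
        |∑ j, (b j : ℝ) * Real.log (α j : ℝ)|) :
    BakerMethodBounds :=
  BakerMethodBounds_of_thm328Finite_kummerArchBound (thm328_rat_finite_of_yu hY) Cw hCw hW

/-- **`BakerMethodBounds` from a `p`-adic bound of Yu's shape with generic constants
`C₃(n) · 7(n+1)² ≤ C₆(n,1)` and a Kummer-conditional archimedean bound with an arbitrary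
constant.** [cite: StewartYu2001, Theorem 1] [cite: EvertseGyory2015, Thm 3.2.7 (p. 62)]
[cite: Waldschmidt1980, Prop 3.8 (p. 274)] -/
theorem BakerMethodBounds_of_padicBound_kummerArchBound (C₃ : ℕ → ℝ)
    (hC₃0 : ∀ n, 2 ≤ n → 0 ≤ C₃ n)
    (hC₃le : ∀ n, 2 ≤ n → C₃ n * (7 * ((n : ℝ) + 1) ^ 2) ≤ egC6 n)
    (hY : ∀ (κ : Type) [Fintype κ] [DecidableEq κ], 2 ≤ Fintype.card κ →
      ∀ (α : κ → ℚ) (b : κ → ℤ) (k₀ : κ) (B Bn δ : ℝ) (p : ℕ), p.Prime →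
        (∀ k, α k ≠ 0) → b k₀ ≠ 0 →
        (∀ k, b k ≠ 0 → padicValInt p (b k₀) ≤ padicValInt p (b k)) →
        (∀ k, (|b k| : ℝ) ≤ B) → Bn ≤ B → (|b k₀| : ℝ) ≤ Bn →
        ∏ k, α k ^ b k - 1 ≠ 0 → 0 < δ → δ ≤ 1 / 2 →
        (padicValRat p (∏ k, α k ^ b k - 1) : ℝ) <
          C₃ (Fintype.card κ) * (p / Real.log p ^ 2) *
            max ((∏ k, max (logHeight₁ (α k)) (1 / (16 * Real.exp 1 ^ 2))) *
                  Real.log (Bn * (2 * Real.exp 1 ^ ((Fintype.card κ + 1) *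
                      (6 * Fintype.card κ + 5)) * Real.log 2) * (p : ℝ) ^ (Fintype.card κ + 1) *
                    (∏ k ∈ univ.erase k₀, max (logHeight₁ (α k)) (1 / (16 * Real.exp 1 ^ 2))) /
                    δ))
              (δ * B / (Bn * (2 ^ (2 * Fintype.card κ + 1) * Real.log 2 * Real.log 3 ^ 3))))
    (Cw : ℕ → ℝ) (hCw : ∀ n, 0 ≤ Cw n)
    (hW : ∀ (n : ℕ) (α : Fin (n + 1) → ℚ) (b : Fin (n + 1) → ℤ) (V : Fin (n + 1) → ℝ) (W E : ℝ),
      (∀ j, 0 < α j ∧ α j ≠ 1) →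
      Module.finrank ℚ ↥(IntermediateField.adjoin ℚ
          (Set.range fun j => Real.sqrt (α j : ℝ))) = 2 ^ (n + 1) →
      Monotone V → 1 ≤ V 0 →
      (∀ j, max (logHeight₁ (α j)) |Real.log (α j : ℝ)| ≤ V j) →
      0 < W → (∀ j, logHeight₁ (b j : ℚ) ≤ W) →
      1 < E → E ≤ Real.exp (V 0) → (∀ j, E ≤ 4 * V j / |Real.log (α j : ℝ)|) →
      ∑ j, (b j : ℝ) * Real.log (α j : ℝ) ≠ 0 →
      Real.exp (-(Cw (n + 1) * (∏ j, V j) * (W + Real.log (E * V (Fin.last n))) *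
          Real.log (E * (if n = 0 then 1 else V ⟨n - 1, by omega⟩)) / Real.log E ^ (n + 2))) <
        |∑ j, (b j : ℝ) * Real.log (α j : ℝ)|) :
    BakerMethodBounds :=
  BakerMethodBounds_of_thm328Finite_kummerArchBound (thm328_rat_finite_of_padicBound C₃ hC₃0 hC₃le hY)
    Cw hCw hW

/-- **Stewart–Yu 2001, Theorem 1 (`abc.S06`,
`Literature.NumberTheory.DiophantineGeometry.stewart_yu`) from Yu's Theorem 3.2.7 over `ℚ` and a
Kummer-conditional archimedean bound with an arbitrary constant.**
[cite: StewartYu2001, Theorem 1] [cite: Waldschmidt1980, Prop 3.8 (p. 274)] -/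
theorem stewart_yu_of_yu_kummerArchBound
    (hY : ∀ (κ : Type) [Fintype κ] [DecidableEq κ], 2 ≤ Fintype.card κ →
      ∀ (α : κ → ℚ) (b : κ → ℤ) (k₀ : κ) (B Bn δ : ℝ) (p : ℕ), p.Prime →
        (∀ k, α k ≠ 0) → b k₀ ≠ 0 →
        (∀ k, b k ≠ 0 → padicValInt p (b k₀) ≤ padicValInt p (b k)) →
        (∀ k, (|b k| : ℝ) ≤ B) → Bn ≤ B → (|b k₀| : ℝ) ≤ Bn →
        ∏ k, α k ^ b k - 1 ≠ 0 → 0 < δ → δ ≤ 1 / 2 →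
        (padicValRat p (∏ k, α k ^ b k - 1) : ℝ) <
          (16 * Real.exp 1) ^ (2 * (Fintype.card κ + 1)) * (Fintype.card κ : ℝ) ^ (3 / 2 : ℝ) *
              Real.log (2 * Fintype.card κ) * Real.log 2 *
            (p / Real.log p ^ 2) *
            max ((∏ k, max (logHeight₁ (α k)) (1 / (16 * Real.exp 1 ^ 2))) *
                  Real.log (Bn * (2 * Real.exp 1 ^ ((Fintype.card κ + 1) *
                      (6 * Fintype.card κ + 5)) * Real.log 2) * (p : ℝ) ^ (Fintype.card κ + 1) *
                    (∏ k ∈ univ.erase k₀, max (logHeight₁ (α k)) (1 / (16 * Real.exp 1 ^ 2))) /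
                    δ))
              (δ * B / (Bn * (2 ^ (2 * Fintype.card κ + 1) * Real.log 2 * Real.log 3 ^ 3))))
    (Cw : ℕ → ℝ) (hCw : ∀ n, 0 ≤ Cw n)
    (hW : ∀ (n : ℕ) (α : Fin (n + 1) → ℚ) (b : Fin (n + 1) → ℤ) (V : Fin (n + 1) → ℝ) (W E : ℝ),
      (∀ j, 0 < α j ∧ α j ≠ 1) →
      Module.finrank ℚ ↥(IntermediateField.adjoin ℚ
          (Set.range fun j => Real.sqrt (α j : ℝ))) = 2 ^ (n + 1) →
      Monotone V → 1 ≤ V 0 →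
      (∀ j, max (logHeight₁ (α j)) |Real.log (α j : ℝ)| ≤ V j) →
      0 < W → (∀ j, logHeight₁ (b j : ℚ) ≤ W) →
      1 < E → E ≤ Real.exp (V 0) → (∀ j, E ≤ 4 * V j / |Real.log (α j : ℝ)|) →
      ∑ j, (b j : ℝ) * Real.log (α j : ℝ) ≠ 0 →
      Real.exp (-(Cw (n + 1) * (∏ j, V j) * (W + Real.log (E * V (Fin.last n))) *
          Real.log (E * (if n = 0 then 1 else V ⟨n - 1, by omega⟩)) / Real.log E ^ (n + 2))) <
        |∑ j, (b j : ℝ) * Real.log (α j : ℝ)|) :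
    Literature.NumberTheory.DiophantineGeometry.stewart_yu :=
  BakerMethodBounds_of_yu_kummerArchBound hY Cw hCw hW

/-! ### The `E = 2` specialisation of the assembly

What remains to be proved on the archimedean side along this route is exactly the hypothesis
`hW₂` below: Waldschmidt's Proposition 3.8 for `K = ℚ`, `q = 2`, at the single admissible value
`E = 2` of his parameter, with any constant. -/

/-- **`BakerMethodBounds` from the `p`-adic clause (constant `K ≥ 1`) and the `E = 2` form of a
Kummer-conditional archimedean bound with an arbitrary constant.**
[cite: StewartYu2001, Theorem 1] [cite: Waldschmidt1980, Prop 3.8 (p. 274)] -/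
theorem BakerMethodBounds_of_padicClause_kummerArchBound₂ (hK : 1 ≤ K)
    (hP2 : ∀ (ι : Type) [Fintype ι], 0 < Fintype.card ι →
      ∀ ξ : ι → ℚ, (∀ i, ξ i ≠ 0 ∧ ξ i ≠ 1 ∧ ξ i ≠ -1) →
      ∀ ζ : ℚ, (ζ = 1 ∨ ζ = -1) → ∀ b : ι → ℤ, ζ * ∏ i, ξ i ^ b i ≠ 1 →
      ∀ p : ℕ, p.Prime →
        (padicValRat p (1 - ζ * ∏ i, ξ i ^ b i) : ℝ) * Real.log p <
          K ^ Fintype.card ι * (p / Real.log p) *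
            Real.log (max (Real.exp 1) (p * logHeight₁ (ζ * ∏ i, ξ i ^ b i))) *
            ∏ i, logHeight₁ (ξ i))
    (Cw : ℕ → ℝ) (hCw : ∀ n, 0 ≤ Cw n)
    (hW₂ : ∀ (n : ℕ) (α : Fin (n + 1) → ℚ) (b : Fin (n + 1) → ℤ) (V : Fin (n + 1) → ℝ) (W : ℝ),
      (∀ j, 0 < α j ∧ α j ≠ 1) →
      Module.finrank ℚ ↥(IntermediateField.adjoin ℚ
          (Set.range fun j => Real.sqrt (α j : ℝ))) = 2 ^ (n + 1) →
      Monotone V → 1 ≤ V 0 →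
      (∀ j, max (logHeight₁ (α j)) |Real.log (α j : ℝ)| ≤ V j) →
      0 < W → (∀ j, logHeight₁ (b j : ℚ) ≤ W) →
      ∑ j, (b j : ℝ) * Real.log (α j : ℝ) ≠ 0 →
      Real.exp (-(Cw (n + 1) * (∏ j, V j) * (W + Real.log (2 * V (Fin.last n))) *
          Real.log (2 * (if n = 0 then 1 else V ⟨n - 1, by omega⟩)) / Real.log 2 ^ (n + 2))) <
        |∑ j, (b j : ℝ) * Real.log (α j : ℝ)|) :
    BakerMethodBounds :=
  bakerShapeBound_third_three_of_padicClause_kummerArchBound₂ hK hP2 Cw hCw hW₂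

/-- **`BakerMethodBounds` from Evertse–Győry's Theorem 3.2.8 over `ℚ` at the finite places and
the `E = 2` form of a Kummer-conditional archimedean bound with an arbitrary constant.**
[cite: StewartYu2001, Theorem 1] [cite: EvertseGyory2015, Thm 3.2.8 (p. 62)]
[cite: Waldschmidt1980, Prop 3.8 (p. 274)] -/
theorem BakerMethodBounds_of_thm328Finite_kummerArchBound₂
    (h328 : ∀ (ι : Type) [Fintype ι], 0 < Fintype.card ι →
      ∀ α : ι → ℚ, (∀ i, α i ≠ 0 ∧ α i ≠ 1 ∧ α i ≠ -1) →
      ∀ β : ℚ, β ≠ 0 → ∀ s : ℤ, (s = 1 ∨ s = -1) → ∀ b : ι → ℤ,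
        (∏ i, α i ^ b i) * β ^ s - 1 ≠ 0 →
      ∀ B : ℝ, (∀ i, (|b i| : ℝ) ≤ B) →
        2 * Real.exp 1 * 9 ^ (Fintype.card ι + 1) * (∏ i, logHeight₁ (α i)) *
            max (logHeight₁ β) 1 ≤ B →
        ∀ p : ℕ, p.Prime →
          -(egC6 (Fintype.card ι + 1) * (p / Real.log p) * (∏ i, logHeight₁ (α i)) *
              max (logHeight₁ β) 1 * logStar (B * p / max (logHeight₁ β) 1)) <
            -(padicValRat p ((∏ i, α i ^ b i) * β ^ s - 1) : ℝ) * Real.log p)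
    (Cw : ℕ → ℝ) (hCw : ∀ n, 0 ≤ Cw n)
    (hW₂ : ∀ (n : ℕ) (α : Fin (n + 1) → ℚ) (b : Fin (n + 1) → ℤ) (V : Fin (n + 1) → ℝ) (W : ℝ),
      (∀ j, 0 < α j ∧ α j ≠ 1) →
      Module.finrank ℚ ↥(IntermediateField.adjoin ℚ
          (Set.range fun j => Real.sqrt (α j : ℝ))) = 2 ^ (n + 1) →
      Monotone V → 1 ≤ V 0 →
      (∀ j, max (logHeight₁ (α j)) |Real.log (α j : ℝ)| ≤ V j) →
      0 < W → (∀ j, logHeight₁ (b j : ℚ) ≤ W) →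
      ∑ j, (b j : ℝ) * Real.log (α j : ℝ) ≠ 0 →
      Real.exp (-(Cw (n + 1) * (∏ j, V j) * (W + Real.log (2 * V (Fin.last n))) *
          Real.log (2 * (if n = 0 then 1 else V ⟨n - 1, by omega⟩)) / Real.log 2 ^ (n + 2))) <
        |∑ j, (b j : ℝ) * Real.log (α j : ℝ)|) :
    BakerMethodBounds :=
  BakerMethodBounds_of_padicClause_kummerArchBound₂ one_le_pastenK (padicClause_of_thm328_finite h328)
    Cw hCw hW₂

/-- **`BakerMethodBounds` from Yu's Theorem 3.2.7 over `ℚ` as printed (Yu 2007; the binder `hY` of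
`Dioph.thm328_rat_finite_of_yu`, verbatim) and the `E = 2` form of a Kummer-conditional
archimedean bound with an arbitrary constant** — the sharpest statement in this file of what the
Stewart–Yu bound needs: on the archimedean side, Waldschmidt's 1980 Proposition 3.8 for `K = ℚ`,
`q = 2`, `E = 2` only. [cite: StewartYu2001, Theorem 1] [cite: EvertseGyory2015, Thm 3.2.7 (p. 62)]
[cite: Waldschmidt1980, Prop 3.8 (p. 274)] -/
theorem BakerMethodBounds_of_yu_kummerArchBound₂
    (hY : ∀ (κ : Type) [Fintype κ] [DecidableEq κ], 2 ≤ Fintype.card κ →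
      ∀ (α : κ → ℚ) (b : κ → ℤ) (k₀ : κ) (B Bn δ : ℝ) (p : ℕ), p.Prime →
        (∀ k, α k ≠ 0) → b k₀ ≠ 0 →
        (∀ k, b k ≠ 0 → padicValInt p (b k₀) ≤ padicValInt p (b k)) →
        (∀ k, (|b k| : ℝ) ≤ B) → Bn ≤ B → (|b k₀| : ℝ) ≤ Bn →
        ∏ k, α k ^ b k - 1 ≠ 0 → 0 < δ → δ ≤ 1 / 2 →
        (padicValRat p (∏ k, α k ^ b k - 1) : ℝ) <
          (16 * Real.exp 1) ^ (2 * (Fintype.card κ + 1)) * (Fintype.card κ : ℝ) ^ (3 / 2 : ℝ) *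
              Real.log (2 * Fintype.card κ) * Real.log 2 *
            (p / Real.log p ^ 2) *
            max ((∏ k, max (logHeight₁ (α k)) (1 / (16 * Real.exp 1 ^ 2))) *
                  Real.log (Bn * (2 * Real.exp 1 ^ ((Fintype.card κ + 1) *
                      (6 * Fintype.card κ + 5)) * Real.log 2) * (p : ℝ) ^ (Fintype.card κ + 1) *
                    (∏ k ∈ univ.erase k₀, max (logHeight₁ (α k)) (1 / (16 * Real.exp 1 ^ 2))) /
                    δ))
              (δ * B / (Bn * (2 ^ (2 * Fintype.card κ + 1) * Real.log 2 * Real.log 3 ^ 3))))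
    (Cw : ℕ → ℝ) (hCw : ∀ n, 0 ≤ Cw n)
    (hW₂ : ∀ (n : ℕ) (α : Fin (n + 1) → ℚ) (b : Fin (n + 1) → ℤ) (V : Fin (n + 1) → ℝ) (W : ℝ),
      (∀ j, 0 < α j ∧ α j ≠ 1) →
      Module.finrank ℚ ↥(IntermediateField.adjoin ℚ
          (Set.range fun j => Real.sqrt (α j : ℝ))) = 2 ^ (n + 1) →
      Monotone V → 1 ≤ V 0 →
      (∀ j, max (logHeight₁ (α j)) |Real.log (α j : ℝ)| ≤ V j) →
      0 < W → (∀ j, logHeight₁ (b j : ℚ) ≤ W) →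
      ∑ j, (b j : ℝ) * Real.log (α j : ℝ) ≠ 0 →
      Real.exp (-(Cw (n + 1) * (∏ j, V j) * (W + Real.log (2 * V (Fin.last n))) *
          Real.log (2 * (if n = 0 then 1 else V ⟨n - 1, by omega⟩)) / Real.log 2 ^ (n + 2))) <
        |∑ j, (b j : ℝ) * Real.log (α j : ℝ)|) :
    BakerMethodBounds :=
  BakerMethodBounds_of_thm328Finite_kummerArchBound₂ (thm328_rat_finite_of_yu hY) Cw hCw hW₂

/-- **`BakerMethodBounds` from a `p`-adic bound of Yu's shape with generic constants
`C₃(n) · 7(n+1)² ≤ C₆(n,1)` and the `E = 2` form of a Kummer-conditional archimedean bound with an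
arbitrary constant.** [cite: StewartYu2001, Theorem 1] [cite: EvertseGyory2015, Thm 3.2.7 (p. 62)]
[cite: Waldschmidt1980, Prop 3.8 (p. 274)] -/
theorem BakerMethodBounds_of_padicBound_kummerArchBound₂ (C₃ : ℕ → ℝ)
    (hC₃0 : ∀ n, 2 ≤ n → 0 ≤ C₃ n)
    (hC₃le : ∀ n, 2 ≤ n → C₃ n * (7 * ((n : ℝ) + 1) ^ 2) ≤ egC6 n)
    (hY : ∀ (κ : Type) [Fintype κ] [DecidableEq κ], 2 ≤ Fintype.card κ →
      ∀ (α : κ → ℚ) (b : κ → ℤ) (k₀ : κ) (B Bn δ : ℝ) (p : ℕ), p.Prime →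
        (∀ k, α k ≠ 0) → b k₀ ≠ 0 →
        (∀ k, b k ≠ 0 → padicValInt p (b k₀) ≤ padicValInt p (b k)) →
        (∀ k, (|b k| : ℝ) ≤ B) → Bn ≤ B → (|b k₀| : ℝ) ≤ Bn →
        ∏ k, α k ^ b k - 1 ≠ 0 → 0 < δ → δ ≤ 1 / 2 →
        (padicValRat p (∏ k, α k ^ b k - 1) : ℝ) <
          C₃ (Fintype.card κ) * (p / Real.log p ^ 2) *
            max ((∏ k, max (logHeight₁ (α k)) (1 / (16 * Real.exp 1 ^ 2))) *
                  Real.log (Bn * (2 * Real.exp 1 ^ ((Fintype.card κ + 1) *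
                      (6 * Fintype.card κ + 5)) * Real.log 2) * (p : ℝ) ^ (Fintype.card κ + 1) *
                    (∏ k ∈ univ.erase k₀, max (logHeight₁ (α k)) (1 / (16 * Real.exp 1 ^ 2))) /
                    δ))
              (δ * B / (Bn * (2 ^ (2 * Fintype.card κ + 1) * Real.log 2 * Real.log 3 ^ 3))))
    (Cw : ℕ → ℝ) (hCw : ∀ n, 0 ≤ Cw n)
    (hW₂ : ∀ (n : ℕ) (α : Fin (n + 1) → ℚ) (b : Fin (n + 1) → ℤ) (V : Fin (n + 1) → ℝ) (W : ℝ),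
      (∀ j, 0 < α j ∧ α j ≠ 1) →
      Module.finrank ℚ ↥(IntermediateField.adjoin ℚ
          (Set.range fun j => Real.sqrt (α j : ℝ))) = 2 ^ (n + 1) →
      Monotone V → 1 ≤ V 0 →
      (∀ j, max (logHeight₁ (α j)) |Real.log (α j : ℝ)| ≤ V j) →
      0 < W → (∀ j, logHeight₁ (b j : ℚ) ≤ W) →
      ∑ j, (b j : ℝ) * Real.log (α j : ℝ) ≠ 0 →
      Real.exp (-(Cw (n + 1) * (∏ j, V j) * (W + Real.log (2 * V (Fin.last n))) *
          Real.log (2 * (if n = 0 then 1 else V ⟨n - 1, by omega⟩)) / Real.log 2 ^ (n + 2))) <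
        |∑ j, (b j : ℝ) * Real.log (α j : ℝ)|) :
    BakerMethodBounds :=
  BakerMethodBounds_of_thm328Finite_kummerArchBound₂
    (thm328_rat_finite_of_padicBound C₃ hC₃0 hC₃le hY) Cw hCw hW₂

/-- **Stewart–Yu 2001, Theorem 1 (`Literature.NumberTheory.DiophantineGeometry.stewart_yu`) from
Yu's Theorem 3.2.7 over `ℚ` and the `E = 2` form of a Kummer-conditional archimedean bound with an
arbitrary constant.** [cite: StewartYu2001, Theorem 1] [cite: Waldschmidt1980, Prop 3.8 (p. 274)] -/
theorem stewart_yu_of_yu_kummerArchBound₂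
    (hY : ∀ (κ : Type) [Fintype κ] [DecidableEq κ], 2 ≤ Fintype.card κ →
      ∀ (α : κ → ℚ) (b : κ → ℤ) (k₀ : κ) (B Bn δ : ℝ) (p : ℕ), p.Prime →
        (∀ k, α k ≠ 0) → b k₀ ≠ 0 →
        (∀ k, b k ≠ 0 → padicValInt p (b k₀) ≤ padicValInt p (b k)) →
        (∀ k, (|b k| : ℝ) ≤ B) → Bn ≤ B → (|b k₀| : ℝ) ≤ Bn →
        ∏ k, α k ^ b k - 1 ≠ 0 → 0 < δ → δ ≤ 1 / 2 →
        (padicValRat p (∏ k, α k ^ b k - 1) : ℝ) <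
          (16 * Real.exp 1) ^ (2 * (Fintype.card κ + 1)) * (Fintype.card κ : ℝ) ^ (3 / 2 : ℝ) *
              Real.log (2 * Fintype.card κ) * Real.log 2 *
            (p / Real.log p ^ 2) *
            max ((∏ k, max (logHeight₁ (α k)) (1 / (16 * Real.exp 1 ^ 2))) *
                  Real.log (Bn * (2 * Real.exp 1 ^ ((Fintype.card κ + 1) *
                      (6 * Fintype.card κ + 5)) * Real.log 2) * (p : ℝ) ^ (Fintype.card κ + 1) *
                    (∏ k ∈ univ.erase k₀, max (logHeight₁ (α k)) (1 / (16 * Real.exp 1 ^ 2))) /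
                    δ))
              (δ * B / (Bn * (2 ^ (2 * Fintype.card κ + 1) * Real.log 2 * Real.log 3 ^ 3))))
    (Cw : ℕ → ℝ) (hCw : ∀ n, 0 ≤ Cw n)
    (hW₂ : ∀ (n : ℕ) (α : Fin (n + 1) → ℚ) (b : Fin (n + 1) → ℤ) (V : Fin (n + 1) → ℝ) (W : ℝ),
      (∀ j, 0 < α j ∧ α j ≠ 1) →
      Module.finrank ℚ ↥(IntermediateField.adjoin ℚ
          (Set.range fun j => Real.sqrt (α j : ℝ))) = 2 ^ (n + 1) →
      Monotone V → 1 ≤ V 0 →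
      (∀ j, max (logHeight₁ (α j)) |Real.log (α j : ℝ)| ≤ V j) →
      0 < W → (∀ j, logHeight₁ (b j : ℚ) ≤ W) →
      ∑ j, (b j : ℝ) * Real.log (α j : ℝ) ≠ 0 →
      Real.exp (-(Cw (n + 1) * (∏ j, V j) * (W + Real.log (2 * V (Fin.last n))) *
          Real.log (2 * (if n = 0 then 1 else V ⟨n - 1, by omega⟩)) / Real.log 2 ^ (n + 2))) <
        |∑ j, (b j : ℝ) * Real.log (α j : ℝ)|) :
    Literature.NumberTheory.DiophantineGeometry.stewart_yu :=
  BakerMethodBounds_of_yu_kummerArchBound₂ hY Cw hCw hW₂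

end AssemblyKummer

/-! ### Complement: the square-root monomials are a basis (the form of the Kummer condition used by the `2`-descent) -/

section MonomialBasis

/-- Products of square-root monomials: `(∏_{S} √αⱼ)(∏_{T} √αⱼ) = (∏_{S ∩ T} αⱼ) · ∏_{S Δ T} √αⱼ`
for `αⱼ ≥ 0`. [folklore] -/
theorem prod_sqrt_mul_prod_sqrt {n : ℕ} (α : Fin n → ℚ) (hα : ∀ j, 0 ≤ α j)
    (S T : Finset (Fin n)) :
    (∏ j ∈ S, Real.sqrt (α j : ℝ)) * (∏ j ∈ T, Real.sqrt (α j : ℝ)) =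
      ((∏ j ∈ S ∩ T, α j : ℚ) : ℝ) * ∏ j ∈ symmDiff S T, Real.sqrt (α j : ℝ) := by
  classical
  set r : Fin n → ℝ := fun j => Real.sqrt (α j : ℝ) with hr
  have hS : ∏ j ∈ S, r j = (∏ j ∈ S \ T, r j) * ∏ j ∈ S ∩ T, r j := by
    rw [← Finset.prod_union (Finset.disjoint_sdiff_inter S T), Finset.sdiff_union_inter]
  have hT : ∏ j ∈ T, r j = (∏ j ∈ T \ S, r j) * ∏ j ∈ S ∩ T, r j := by
    rw [Finset.inter_comm, ← Finset.prod_union (Finset.disjoint_sdiff_inter T S),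
      Finset.sdiff_union_inter]
  have hsq : (∏ j ∈ S ∩ T, r j) * (∏ j ∈ S ∩ T, r j) = ((∏ j ∈ S ∩ T, α j : ℚ) : ℝ) := by
    rw [← Finset.prod_mul_distrib, Rat.cast_prod]
    refine Finset.prod_congr rfl fun j _ => ?_
    rw [hr]; exact Real.mul_self_sqrt (by exact_mod_cast hα j)
  have hΔ : ∏ j ∈ symmDiff S T, r j = (∏ j ∈ S \ T, r j) * ∏ j ∈ T \ S, r j := by
    rw [symmDiff_def, Finset.sup_eq_union, Finset.prod_union disjoint_sdiff_sdiff]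
  rw [hS, hT, hΔ, ← hsq]; ring

/-- **The square-root monomials are linearly independent over `ℚ`** when the square classes are
independent: the `2ⁿ` products `∏_{j ∈ S} √αⱼ`, `S ⊆ {0, …, n-1}`, span the field
`ℚ(√α₀, …, √α_{n-1})` (their `ℚ`-span is a subalgebra containing the generators), whose degree is
`2ⁿ` (`finrank_adjoin_sqrt_eq_two_pow`). This is the form in which the Kummer condition is used
in Baker's `2`-descent (Waldschmidt 1980, p. 273: "we express the numbers `φ(s/q)` on the basis
`{α₁^{l₁/q} ⋯ αₙ^{lₙ/q}}`"). [folklore] -/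
theorem linearIndependent_prod_sqrt {n : ℕ} (α : Fin n → ℚ) (hα : ∀ j, 0 ≤ α j)
    (hind : ∀ T : Finset (Fin n), T.Nonempty → ¬ IsSquare (∏ j ∈ T, α j)) :
    LinearIndependent ℚ (fun S : Finset (Fin n) => ∏ j ∈ S, Real.sqrt (α j : ℝ)) := by
  classical
  set v : Finset (Fin n) → ℝ := fun S => ∏ j ∈ S, Real.sqrt (α j : ℝ) with hv
  set E : IntermediateField ℚ ℝ :=
    IntermediateField.adjoin ℚ (Set.range fun j => Real.sqrt (α j : ℝ)) with hE
  have hfin : Module.finrank ℚ ↥E = 2 ^ n := finrank_adjoin_sqrt_eq_two_pow α hα hind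
  set V : Submodule ℚ ℝ := Submodule.span ℚ (Set.range v) with hV
  -- `V` is closed under multiplication and contains `1`
  have hVmul : ∀ x y, x ∈ V → y ∈ V → x * y ∈ V := by
    intro x y hx hy
    have hxy : x * y ∈ V * V := Submodule.mul_mem_mul hx hy
    rw [hV, Submodule.span_mul_span] at hxy
    refine (Submodule.span_le.mpr ?_) hxy
    rintro _ ⟨a, ⟨S, rfl⟩, b, ⟨T, rfl⟩, rfl⟩
    show v S * v T ∈ Submodule.span ℚ (Set.range v)
    have hprod : v S * v T = (∏ j ∈ S ∩ T, α j : ℚ) • v (symmDiff S T) := by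
      rw [Algebra.smul_def]
      exact prod_sqrt_mul_prod_sqrt α hα S T
    rw [hprod]
    exact Submodule.smul_mem _ _ (Submodule.subset_span ⟨symmDiff S T, rfl⟩)
  have h1 : (1 : ℝ) ∈ V := Submodule.subset_span ⟨∅, by simp [hv]⟩
  set A : Subalgebra ℚ ℝ := V.toSubalgebra h1 hVmul with hA
  have halg : ∀ x ∈ Set.range (fun j => Real.sqrt (α j : ℝ)), IsAlgebraic ℚ x := by
    rintro _ ⟨j, rfl⟩
    have hint : IsIntegral ℚ (Real.sqrt (α j : ℝ) ^ 2) := by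
      have : Real.sqrt (α j : ℝ) ^ 2 = algebraMap ℚ ℝ (α j) := by
        rw [sq, Real.mul_self_sqrt (by exact_mod_cast hα j)]; rfl
      rw [this]; exact isIntegral_algebraMap
    exact (hint.of_pow two_pos).isAlgebraic
  have hEA : E.toSubalgebra ≤ A := by
    rw [hE, IntermediateField.adjoin_toSubalgebra_of_isAlgebraic halg]
    refine Algebra.adjoin_le ?_
    rintro _ ⟨j, rfl⟩
    show Real.sqrt (α j : ℝ) ∈ V
    exact Submodule.subset_span ⟨{j}, by simp [hv]⟩
  have hVE : V = Subalgebra.toSubmodule E.toSubalgebra := by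
    apply le_antisymm
    · rw [hV, Submodule.span_le]
      rintro _ ⟨S, rfl⟩
      show v S ∈ E
      exact prod_mem fun j _ => IntermediateField.subset_adjoin ℚ _ ⟨j, rfl⟩
    · intro x hx; exact hEA hx
  rw [linearIndependent_iff_card_eq_finrank_span, Fintype.card_finset, Fintype.card_fin]
  show 2 ^ n = Module.finrank ℚ ↥(Submodule.span ℚ (Set.range v))
  rw [← hV, hVE, Subalgebra.finrank_toSubmodule]
  exact hfin.symm

end MonomialBasis

/-! ### The Kummer condition in an arbitrary field; distinct primes together with `-1`

The `ℝ`-free form of `finrank_adjoin_sqrt_eq_two_pow` (square roots taken in any field `L ⊇ ℚ`,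
e.g. `ℂ` or `ℂ_p`), and its instance for the generators `p₀, …, p_{k-1}, -1`: this is hypothesis
(2.15) `[K(α₀^{1/q}, α₁^{1/q}, …, αₙ^{1/q}) : K] = q^{n+1}` of Yu 1990, Theorem 2.1 / Corollary 2.3
in the case `K = ℚ`, `q = 2`, `u = 1`, `α₀ = -1` with rational prime generators — the `ℚ`-analogue
of Stewart–Yu 1991, Lemma 3 (there `K = ℚ(ζ₄)`, and the generator `2` is replaced by `1 + i`).
* Kunrui Yu, *Linear forms in p-adic logarithms II*, Compositio Math. 74 (1990), 15–113: §2,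
  (2.1)–(2.6) p. 30, (2.15) p. 31.
* C. L. Stewart, Kunrui Yu, *On the abc conjecture*, Math. Ann. 291 (1991), Lemma 3 (p. 227). -/

section KummerNegOne

open Multiquadratic in
/-- **The Kummer condition at `q = 2` in an arbitrary field.** If `L` is a field containing `ℚ`
and `y₀, …, y_{n-1} ∈ L` satisfy `yⱼ² = αⱼ` with `αⱼ ∈ ℚ` such that no product of a non-empty
subfamily of the `αⱼ` is a square in `ℚ`, then `[ℚ(y₀, …, y_{n-1}) : ℚ] = 2ⁿ` (the `ℝ`-free form
of `finrank_adjoin_sqrt_eq_two_pow`: square roots of negative rationals, taken in `ℂ` or in `ℂ_p`).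
It is the `n`-fold iteration, for `p = 2` and base field `ℚ`, of the Baker–Stark Kummer lemma as
quoted in Yu 1990, Lemma 1.9: either `K'(αₙ^{1/p})` has degree `p` over
`K' = K(α₁^{1/p}, …, α_{n-1}^{1/p})`, or `αₙ = α₁^{j₁}⋯α_{n-1}^{j_{n-1}}γ^p` with `γ ∈ K`.
[cite: Yu1990, Lemma 1.9 (p. 28), iterated (= Baker–Stark 1971, Lemma 3)] -/
theorem finrank_adjoin_eq_two_pow_of_mul_self_eq {L : Type*} [Field L] [Algebra ℚ L] {n : ℕ}
    (α : Fin n → ℚ) (y : Fin n → L) (hy : ∀ j, y j * y j = algebraMap ℚ L (α j))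
    (hind : ∀ T : Finset (Fin n), T.Nonempty → ¬ IsSquare (∏ j ∈ T, α j)) :
    Module.finrank ℚ ↥(IntermediateField.adjoin ℚ (Set.range y)) = 2 ^ n := by
  classical
  -- extend the families to `ℕ`
  set c : ℕ → ℚ := fun i => if h : i < n then α ⟨i, h⟩ else 0 with hc
  set y' : ℕ → L := fun i => if h : i < n then y ⟨i, h⟩ else 0 with hy'
  have hyc : ∀ i, algebraMap ℚ L (c i) = y' i * y' i := by
    intro i
    by_cases h : i < n
    · simp only [hc, hy', dif_pos h]; exact (hy _).symm
    · simp only [hc, hy', dif_neg h, map_zero, mul_zero]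
  have hrange : Set.range y = y' '' {i | i < n} := by
    ext z
    simp only [Set.mem_range, Set.mem_image, Set.mem_setOf_eq]
    constructor
    · rintro ⟨j, rfl⟩
      exact ⟨j, j.2, by simp [hy', j.2]⟩
    · rintro ⟨i, hi, rfl⟩
      exact ⟨⟨i, hi⟩, by simp [hy', hi]⟩
  have hind' : ∀ T : Finset ℕ, (∀ i ∈ T, i < n) → T.Nonempty → ¬ IsSquare (∏ i ∈ T, c i) := by
    intro T hT hTne hsq
    set T' : Finset (Fin n) := Finset.univ.filter fun j => (j : ℕ) ∈ T with hT'
    have hmap : T'.map Fin.valEmbedding = T := by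
      ext i
      simp only [Finset.mem_map, Finset.mem_filter, Finset.mem_univ, true_and,
        Fin.valEmbedding_apply, hT']
      constructor
      · rintro ⟨j, hj, rfl⟩; exact hj
      · intro hi; exact ⟨⟨i, hT i hi⟩, hi, rfl⟩
    have hprod : ∏ i ∈ T, c i = ∏ j ∈ T', α j := by
      rw [← hmap, Finset.prod_map]
      refine Finset.prod_congr rfl fun j _ => ?_
      simp [hc, j.2]
    have hT'ne : T'.Nonempty := by
      obtain ⟨i, hi⟩ := hTne
      exact ⟨⟨i, hT i hi⟩, by simp [hT', hi]⟩
    exact hind T' hT'ne (hprod ▸ hsq)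
  have h2 : (2 : L) ≠ 0 := by
    have h := (algebraMap ℚ L).injective.ne (two_ne_zero (α := ℚ))
    simpa using h
  rw [hrange]
  exact (finrank_adjoin_image_sqrt_and_sq h2 y' c hyc n hind' n le_rfl).1

/-- **Kummer condition for distinct primes together with `-1`.** In any field `L ⊇ ℚ`, square
roots `y₀, …, y_{k-1}` of distinct primes `p₀, …, p_{k-1}` and a square root `y_k` of `-1`
generate an extension of degree `[ℚ(y₀, …, y_k) : ℚ] = 2^{k+1}` (by `not_isSquare_prod_snoc` with
`β₀ = -1`: `-1` is not a square and is a unit at every prime). This is hypothesis (2.15) of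
Yu 1990, Theorem 2.1 for `K = ℚ`, `q = 2`, `α₀ = -1` and rational prime generators; compare
Stewart–Yu 1991, Lemma 3 (over `ℚ(ζ₄)`, with `2` replaced by `1 + i`). [folklore]
[cite: Yu1990, §2 (2.15), p. 31] [cite: StewartYu1991, Lemma 3 (p. 227)] -/
theorem finrank_adjoin_sqrt_primes_and_neg_one {L : Type*} [Field L] [Algebra ℚ L] {k : ℕ}
    (pr : Fin k → ℕ) (hpr : ∀ i, (pr i).Prime) (hinj : Function.Injective pr)
    (y : Fin (k + 1) → L)
    (hy : ∀ j, y j * y j =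
      algebraMap ℚ L ((Fin.snoc (fun i => (pr i : ℚ)) (-1 : ℚ) : Fin (k + 1) → ℚ) j)) :
    Module.finrank ℚ ↥(IntermediateField.adjoin ℚ (Set.range y)) = 2 ^ (k + 1) :=
  finrank_adjoin_eq_two_pow_of_mul_self_eq _ y hy
    (not_isSquare_prod_snoc pr hpr hinj (β₀ := -1) (by norm_num)
      (by rintro ⟨r, hr⟩; nlinarith [mul_self_nonneg r])
      (fun i => by
        haveI : Fact (pr i).Prime := ⟨hpr i⟩
        rw [padicValRat.neg, padicValRat.one]))

/-- **`[ℚ(i, √p₀, …, √p_{k-1}) : ℚ] = 2^{k+1}`** for distinct primes `pᵢ` (in `ℂ`, with the real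
square roots `√pᵢ` and `i = Complex.I`). [folklore] [cite: Yu1990, §2 (2.15), p. 31] -/
theorem finrank_adjoin_sqrt_primes_I {k : ℕ} (pr : Fin k → ℕ) (hpr : ∀ i, (pr i).Prime)
    (hinj : Function.Injective pr) :
    Module.finrank ℚ ↥(IntermediateField.adjoin ℚ (Set.range
      (Fin.snoc (fun i => ((Real.sqrt (pr i) : ℝ) : ℂ)) Complex.I : Fin (k + 1) → ℂ))) =
      2 ^ (k + 1) := by
  refine finrank_adjoin_sqrt_primes_and_neg_one pr hpr hinj _ fun j => ?_
  rcases Fin.eq_castSucc_or_eq_last j with ⟨i, rfl⟩ | rfl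
  · simp only [Fin.snoc_castSucc, eq_ratCast, Rat.cast_natCast]
    rw [← Complex.ofReal_mul, Real.mul_self_sqrt (Nat.cast_nonneg _)]
    push_cast; rfl
  · simp only [Fin.snoc_last, Complex.I_mul_I, eq_ratCast]
    push_cast; rfl

end KummerNegOne

end Literature.Barriers.ABC

end
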